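import Literature.MathematicalPhysics.QuantumFieldTheory.Balaban1983to89.B2Eq268GaugeAway

/-!
# `Balaban1983to89.B2Lemma27CovarianceBox` — support for [Balaban1982Higgs2] **Lemma 2.7** (2.113) p. 581: the unit-lattice
# covariance `C^{(k)}(□, Ã) = (Δ^{(k)}(□,Ã) + aL⁻²P(Ã))⁻¹` of (I.2.32)/[B4] (1.13)–(1.14) on the B4 lineage's fine box, its
# gauge covariance at a constant field, its zero-field value `aL⁻²C^{(k)}(□)1` (the number of (2.85)) EXACT on the box, and
# its expansion in `A′ = Ã − A₀` — «the ideas … of Lemmas 2.4 and 2.5» the omitted proof of Lemma 2.7 refers to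

statement-level skeleton of published theorems with citation tags; proofs where landed; nothing here is a claim about the Yang–Mills mass gap

CITATION HEADER.  T. Bałaban, *(Higgs)₂,₃ quantum fields in a finite volume. II. An upper bound*, Commun. Math. Phys.
**86** (1982) 555–594, doi:10.1007/bf01214890 [Balaban1982Higgs2] (cell paper B2; journal page = PDF page + 554; pp. 572–575,
580–581 READ AS IMAGES on the ×2 renders `run/shared/lean/pub/pub-balaban/b2b-balaban-ref1/pages/1982-cmp86-higgs23-II/
1982-cmp86-higgs23-II-p018…p021-x2.png`, `-p026/p027-x2.png`); operators of T. Bałaban, *… III. Regularity and decay of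
lattice Green's functions*, Commun. Math. Phys. **89** (1983) 571–597 [Balaban1983RegularityDecay] (= B4), (1.4)–(1.6) p. 572,
(1.13)–(1.14) p. 573, Lemma 2.4 (2.37) p. 582, as typed by the lineage `B4GaugeCovariance` → `B4Lemma22*` → `B2Eq268GaugeAway`
(p249407) and by `B4BoxCov237` (the zero-field unit-lattice covariance `covOp⁻¹`, PROVED exponentially decaying there).  Cell
`lit-balaban`, Phase-2 proof seat **p23** gen 5, unit `lit-balaban-p23-g5`; support file 1/2 for SKELETON row **B2.Lem2.7**
(decl of record `…B2Sect2Statements.Lemma27Printed`, twin `…B2StepK.Lemma27Printed`, both UNCHANGED; proved for a model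
family in the sibling `B2Lemma27Proof`); fold owner r02, referee ref-4.

WHAT IS PRINTED (verbatim).  p. 581 [PDF 27]: *"To obtain small fields on the set Λ₅^{(k)} we make the translation
φ = φ′ + aL⁻²C^{(k)}_{Λ₄^{(k)}}(B^k(Λ₂^{(k)}), B^{(k+1),η})Q*(B^{(k+1),η})ψ. (2.110) […] **Lemma 2.7.** The following estimate holds
aL⁻²(C^{(k)}_{Λ₄^{(k)}}(B^k(Λ₂^{(k)}), B^{(k+1),η})Q*(B^{(k+1),η})ψ)(x) = (Q*(B^{(k+1),η})ψ)(x) + O(p(L^kε)), x ∈ Λ₅^{(k)}. (2.113)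
A proof of this lemma is based on the ideas which were described before in the proofs of Lemmas 2.4 and 2.5, so we omit it
here."*  Those ideas, pp. 572–575: the expansion (2.68) «Using the expansion formula (I.3.44) and Proposition I.2.2», the
gauge-away of a constant field (2.69)–(2.75) «the constant field A₀ can be "gauged out"», «G_k(□, A₀; x, x′) =
U(A₀(Γ_{x,y}))G_k(□, 0; x, x′)U(A₀(Γ_{y,x′}))» (2.73), and the zero-field value (2.83)–(2.85) «aL⁻²C^{(k)}1 = C^{(k)}aL⁻²P1 =
C^{(k)}(Δ^{(k)} + aL⁻²P)1 − C^{(k)}Δ^{(k)}1 = 1 − C^{(k)}Δ^{(k)}1 (2.83) … aL⁻²C^{(k)}1 = (1 + a⁻¹L²a_kμ₀²(L^kε)²/(a_k + μ₀²(L^kε)²))⁻¹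
= 1 + O(μ₀²(L^kε)²) (2.85)»; [B4] p. 573: «C^{(k)}_Λ(Ω, A) = ((Δ^{(k)}(Ω, A) + aL⁻²P(A))|_Λ)⁻¹ (1.13) … Δ^{(k)}(Ω, A) = a_kI −
a_k²Q_k(A)G_k(Ω, A)Q_k^*(A) (1.14)».

DICTIONARY (indicator-weight coordinates of the lineage).  Fine box `□ = Box d ℓ k (M2 ℓ M′)` (sides `L^k·L·M′_μ`, `n = L^k`
points per unit length), unit sites `boxDom (M2 ℓ M′)` (`M2 ℓ M′ = L·M′`, a box of whole `L`-blocks), coarse sites `boxDom M′`;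
`Q_k(Ã) = n^{−(d+1)}·avgA Ã`, `Q_k^*(Ã) = (avgA Ã)ᵀ` (`B2Eq268GaugeAway.avgA`, block contours `Γ` from `emb y`); one level up
`Q(Ã) = L^{−(d+1)}·avgU Ã`, `Q^*(Ã) = (avgU Ã)ᵀ` (`avgU`, unit-level contours `Γ′` from the coarse base points `emb′ z` to the
unit base points `emb y`, transporters `transU`); `G_k(□,Ã) = greenA Ã`; hence `Δ^{(k)}(□,Ã) + aL⁻²P(Ã) = Mop Ã` and `C^{(k)}(□,Ã) =
Cop Ã = (Mop Ã)⁻¹`; at a constant field `A₀` the gauge `ℋ = ⊕_y U(κλ(emb y))` (`blockDiag (gaugeU ∘ emb)`).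

WHAT IS PROVED (all from the lineage's definitions; no hypotheses beyond the displayed ones; 0 facts, no `sorry`).
§1 `transU`, `avgU`, `fld_avgU_transpose` (`(Q^*ψ)(y) = U(Ã(Γ′_{z(y),y}))ᵀψ(z(y))`), the Kronecker identifications
`avgOne = indB ⊗ 1`, `avgOneU = indB′ ⊗ 1`, `indB′ᵀindB′ = L^{d+1}·blockAvgP`; §2 `Mop`, `Cop`, `transU_constBond`,
`avgU_constBond` (`Q(A₀) = ℋ′QℋT`), **`Mop_constBond`**: `Δ^{(k)}(□,A₀) + aL⁻²P(A₀) = ℋ(covOp ⊗ 1)ℋᵀ` with `covOp` THE zero-field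
matrix of `B4BoxCov237`, **`Cop_constBond`**: `C^{(k)}(□,A₀) = ℋ(covOp⁻¹ ⊗ 1)ℋᵀ`, `isUnit_det_Mop_constBond`; the values
`Keff_mulVec_one` ((2.83)–(2.84): `Δ^{(k)}(□)1 = a_km²/(a_k+m²)·1`), `blockAvgP_mulVec_one`, `covOp_mulVec_one`, **`covOp_inv_rowsum`**
((2.85) EXACT: `aL⁻²Σ_{y′}C^{(k)}(□;y,y′) = aL⁻²/(aL⁻² + a_km²/(a_k+m²))`); §3 sup-norm tools (`avgA_site_le`, `avgA_sub_site_le`,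
`avgU_site_le`, `avgU_sub_site_le`, `avgUT_site_le`, `avgUT_sub_site_le`, `kron_site_le`, gauge invariance of `‖·‖_∞`,
`supN_conj_kron_le`); §4 **`expansion_bound`** (the resolvent step: `C₀M₀ = 1`, `M₁C₁ = 1`, `‖C₀‖ ≤ c₀`, `‖M₁ − M₀‖ ≤ μ`,
`2c₀μ ≤ 1` ⇒ `‖C₁‖ ≤ 2c₀`, `‖C₁ − C₀‖ ≤ 2c₀²μ`), `gOp` (`a_kG_kQ_k^*` as an operator), `Mop_sub_mulVec`, **`Mop_sub_bound`**
(`‖(Δ^{(k)}+aL⁻²P)(Ã) − (Δ^{(k)}+aL⁻²P)(A₀)‖_{∞→∞} ≤ a_k(ℓ₁τc_I + ρ) + 2aL⁻²ℓ₁τ′` from the holonomy sizes `τ, τ′` of `A′`, a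
Proposition-I.2.2 operator bound `c_I` and a (2.68)-remainder operator bound `ρ`).

HONEST SCOPE.  (a) Lemma 2.7 has NO printed proof; this file and its sibling are a RECONSTRUCTION following the paper's
one-line hint, in the lineage's typed setting; every theorem here is an identity or an elementary estimate about the lineage's
concrete operators.  (b) `covOp` is B4's zero-field `Δ^{(j)}(□) + a₂L⁻²P` on a box of `L`-blocks with Neumann conditions and
NO further Dirichlet restriction `|_Λ` — the localization of `C^{(k)}_{Λ₄}(Ω, ·)` to such a box is the sibling's Proposition-I.2.3
input, as (2.67) was for Lemma 2.4.  (c) Colour group: any abelian orthogonal flow (`OrthFlow`); contour systems: any systems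
ending at the averaged base points (`hend`, `hend′`).  (d) NOT summit progress; a kernel certificate of operator identities.
-/

namespace Literature.MathematicalPhysics.QuantumFieldTheory.Balaban1983to89.B2Lemma27CovarianceBox

open Finset Matrix
open scoped Kronecker
open Literature.MathematicalPhysics.QuantumFieldTheory.Balaban1983to89.B4GaugeCovariance
open Literature.MathematicalPhysics.QuantumFieldTheory.Balaban1983to89.B4Lower18Regular (e1 lsum fieldLink_add
  transport_fieldLink sum_blkWt_row)
open Literature.MathematicalPhysics.QuantumFieldTheory.Balaban1983to89.B4Lemma21Region (siteNorm covDeriv)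
open Literature.MathematicalPhysics.QuantumFieldTheory.Balaban1983to89.B4Reflection242 (nbrs boxDom blk blk_mem_boxDom)
open Literature.MathematicalPhysics.QuantumFieldTheory.Balaban1983to89.B4ContourShift (supNorm supNorm_nonneg)
open Literature.MathematicalPhysics.QuantumFieldTheory.Balaban1983to89.B4BoxCov237 (boxOpR boxOpR_det_isUnit indB Keff
  blockAvgP covOp cov237_box_decay card_filter_blk)
open Literature.MathematicalPhysics.QuantumFieldTheory.Balaban1983to89.B4Lemma22Reduce231
open Literature.MathematicalPhysics.QuantumFieldTheory.Balaban1983to89.B4Lemma22ReduceZero (siteNorm_sum_le Box gk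
  greenA greenA0 opA derivA derivA0 fld_kron_mulVec)
open Literature.MathematicalPhysics.QuantumFieldTheory.Balaban1983to89.B4Lemma22ReduceDeriv (siteNorm_flow fld_sub
  siteNorm_flow_sub_one_le)
open Literature.MathematicalPhysics.QuantumFieldTheory.Balaban1983to89.B4Lemma22PertVSup (siteNorm_neg supN_neg
  supN_smul_le constBond_antisymm blkWt_nonneg contourTrans_fieldLink fld_avgOp_transpose_mulVec avgT_site)
open Literature.MathematicalPhysics.QuantumFieldTheory.Balaban1983to89.B4Lemma24ZeroBoxAlphaNegMesh (boxOpR_mulVec_one)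
open Literature.MathematicalPhysics.QuantumFieldTheory.Balaban1983to89.B2Eq268GaugeAway

noncomputable section

variable {ι : Type} [Fintype ι] [DecidableEq ι]

/-! ## §1 The carriers one `L`-block level up, the unit-level transporters and `Q(Ã)` -/

section Objects

variable {d : ℕ}

/-- the unit box `□^{(k)} = Π[0, L·M′_μ) ∩ ℤ^{d+1}` of a box of `L`-blocks with coarse sides `M′`. [folklore] -/
abbrev M2 (ℓ : ℕ) (M' : Fin (d + 1) → ℕ) : Fin (d + 1) → ℕ := fun i => (ℓ + 1) * M' i

variable (d) in
/-- **THE UNIT-LEVEL TRANSPORTERS** `U(Ã(Γ′_{z,y}))` along the contours from the base point of the coarse site `z` to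
the base point `emb y` of the unit site `y ∈ B(z)` (the transporters of `Q(B^{(k+1),η})` in (2.113); paths in the fine
box, link variables `U(κÃ_b)`). [cite: Balaban1982Higgs2, (2.113) p. 581; Balaban1983RegularityDecay, (1.4) p. 572] -/
def transU (F : OrthFlow ι) (κ : ℝ) (ℓ k : ℕ) (M' : Fin (d + 1) → ℕ)
    (emb' : ↥(boxDom M') → ↥(Box d ℓ k (M2 ℓ M')))
    (Γ' : ↥(boxDom M') → ↥(boxDom (M2 ℓ M')) → List ↥(Box d ℓ k (M2 ℓ M')))
    (A : ↥(Box d ℓ k (M2 ℓ M')) → ↥(Box d ℓ k (M2 ℓ M')) → ℝ) :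
    ↥(boxDom M') → ↥(boxDom (M2 ℓ M')) → Matrix ι ι ℝ :=
  fun z y => transport (fieldLink F κ A) (emb' z) (Γ' z y)

variable (d) in
/-- **`Q(Ã)` ONE LEVEL UP, INDICATOR WEIGHTS**: `avgU = L^{d+1}·Q(Ã)` from unit-lattice fields to `L`-lattice fields,
so that `Q^*(Ã) = avgUᵀ` («(Q^*(B^{(k+1),η})ψ)(x)» of (2.113)). [cite: Balaban1982Higgs2, (2.113) p. 581] -/
def avgU (F : OrthFlow ι) (κ : ℝ) (ℓ k : ℕ) (M' : Fin (d + 1) → ℕ)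
    (emb' : ↥(boxDom M') → ↥(Box d ℓ k (M2 ℓ M')))
    (Γ' : ↥(boxDom M') → ↥(boxDom (M2 ℓ M')) → List ↥(Box d ℓ k (M2 ℓ M')))
    (A : ↥(Box d ℓ k (M2 ℓ M')) → ↥(Box d ℓ k (M2 ℓ M')) → ℝ) :
    Matrix (↥(boxDom M') × ι) (↥(boxDom (M2 ℓ M')) × ι) ℝ :=
  avgOp (blkWt (ℓ + 1) M' (M2 ℓ M')) (transU d F κ ℓ k M' emb' Γ' A)

variable (ι d) in
/-- `Q` one level up at zero field (indicator weights, trivial transporters). [cite: Balaban1983RegularityDecay, (1.13) p. 573] -/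
abbrev avgOneU (ℓ : ℕ) (M' : Fin (d + 1) → ℕ) : Matrix (↥(boxDom M') × ι) (↥(boxDom (M2 ℓ M')) × ι) ℝ :=
  avgOp (blkWt (ℓ + 1) M' (M2 ℓ M')) (fun _ _ => (1 : Matrix ι ι ℝ))

variable (d) in
/-- the coarse site `z(y)` of the `L`-block `B(z(y)) ∋ y` of a unit site. [folklore] -/
def cSite (ℓ : ℕ) (M' : Fin (d + 1) → ℕ) (y : ↥(boxDom (M2 ℓ M'))) : ↥(boxDom M') :=
  ⟨blk (ℓ + 1) y.1, blk_mem_boxDom (Nat.succ_pos ℓ) y.2⟩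

/-- the unit-level block weight selects the coarse site: `q(z,y) = 1[z = z(y)]`. [cite: Balaban1983RegularityDecay, (1.4) p. 572] -/
theorem blkWtU_eq_ite (ℓ : ℕ) (M' : Fin (d + 1) → ℕ) (z : ↥(boxDom M')) (y : ↥(boxDom (M2 ℓ M'))) :
    blkWt (ℓ + 1) M' (M2 ℓ M') z y = if z = cSite d ℓ M' y then 1 else 0 := by
  unfold blkWt cSite
  by_cases h : blk (ℓ + 1) y.1 = z.1
  · rw [if_pos h, if_pos (Subtype.ext h.symm)]
  · rw [if_neg h, if_neg fun e => h (congrArg Subtype.val e).symm]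

/-- **`(Q^*(Ã)ψ)(y) = U(Ã(Γ′_{z(y),y}))ᵀψ(z(y))`** (weight-1 adjoint). [cite: Balaban1982Higgs2, (2.113) p. 581] -/
theorem fld_avgU_transpose (F : OrthFlow ι) (κ : ℝ) (ℓ k : ℕ) (M' : Fin (d + 1) → ℕ)
    (emb' : ↥(boxDom M') → ↥(Box d ℓ k (M2 ℓ M')))
    (Γ' : ↥(boxDom M') → ↥(boxDom (M2 ℓ M')) → List ↥(Box d ℓ k (M2 ℓ M')))
    (A : ↥(Box d ℓ k (M2 ℓ M')) → ↥(Box d ℓ k (M2 ℓ M')) → ℝ) (ψ : ↥(boxDom M') × ι → ℝ)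
    (y : ↥(boxDom (M2 ℓ M'))) :
    fld ((avgU d F κ ℓ k M' emb' Γ' A)ᵀ *ᵥ ψ) y
      = (transU d F κ ℓ k M' emb' Γ' A (cSite d ℓ M' y) y)ᵀ *ᵥ fld ψ (cSite d ℓ M' y) := by
  dsimp only [avgU]
  rw [fld_avgOp_transpose_mulVec, Finset.sum_eq_single (cSite d ℓ M' y)]
  · rw [blkWtU_eq_ite, if_pos rfl, one_smul]
  · intro z _ hz
    rw [blkWtU_eq_ite, if_neg hz, zero_smul]
  · intro h; exact absurd (Finset.mem_univ _) h

omit [DecidableEq ι] in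
/-- `(Q^*1ψ′)(y) = ψ′(z(y))` at zero field. [cite: Balaban1983RegularityDecay, (1.13) p. 573] -/
theorem fld_avgOneUT [DecidableEq ι] (ℓ : ℕ) (M' : Fin (d + 1) → ℕ) (ψ : ↥(boxDom M') × ι → ℝ)
    (y : ↥(boxDom (M2 ℓ M'))) :
    fld ((avgOneU ι d ℓ M')ᵀ *ᵥ ψ) y = fld ψ (cSite d ℓ M' y) := by
  rw [fld_avgOp_transpose_mulVec, Finset.sum_eq_single (cSite d ℓ M' y)]
  · rw [blkWtU_eq_ite, if_pos rfl, one_smul, Matrix.transpose_one, one_mulVec]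
  · intro z _ hz
    rw [blkWtU_eq_ite, if_neg hz, zero_smul]
  · intro h; exact absurd (Finset.mem_univ _) h

omit [Fintype ι] in
/-- a weight-`q` average with trivial transporters is the Kronecker product `q ⊗ 1` ([B4] (1.4) at `A = 0`: «Q_k(0)»).
[cite: Balaban1983RegularityDecay, (1.4) p. 572] -/
theorem avgOp_one_eq_kron {X Y : Type*} (q : Y → X → ℝ) :
    avgOp q (fun _ _ => (1 : Matrix ι ι ℝ)) = Matrix.of q ⊗ₖ (1 : Matrix ι ι ℝ) := by
  ext ⟨y, i⟩ ⟨x, j⟩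
  simp [avgOp, blockOp, Matrix.kroneckerMap_apply, Matrix.smul_apply]

/-- the fine block weights are the block indicator `indB` ((1.4): «x ∈ B^k(y)»). [cite: Balaban1983RegularityDecay, (1.4) p. 572] -/
theorem of_blkWt_eq_indB (n : ℕ) (M : Fin (d + 1) → ℕ) :
    Matrix.of (blkWt n M (fun i => n * M i)) = indB n M := by
  ext y x; rfl

omit [Fintype ι] in
/-- `avgOne = indB ⊗ 1` (fine level). [cite: Balaban1983RegularityDecay, (1.4) p. 572, dictionary] -/
theorem avgOne_eq_kron (ℓ k : ℕ) (M : Fin (d + 1) → ℕ) :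
    avgOne ι d ℓ k M = indB ((ℓ + 1) ^ k) M ⊗ₖ (1 : Matrix ι ι ℝ) := by
  rw [avgOne, avgOp_one_eq_kron, of_blkWt_eq_indB]

omit [Fintype ι] in
/-- `avgOneU = indB′ ⊗ 1` (unit level). [cite: Balaban1983RegularityDecay, (1.13) p. 573, dictionary] -/
theorem avgOneU_eq_kron (ℓ : ℕ) (M' : Fin (d + 1) → ℕ) :
    avgOneU ι d ℓ M' = indB (ℓ + 1) M' ⊗ₖ (1 : Matrix ι ι ℝ) := by
  rw [avgOneU, avgOp_one_eq_kron, of_blkWt_eq_indB]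

/-- `indB′ᵀindB′ = L^{d+1}·P` (`P` = `B4BoxCov237.blockAvgP`, the `L`-block averaging projection).
[cite: Balaban1983RegularityDecay, (1.13) p. 573 «P(A) = Q^*(A)Q(A)»] -/
theorem indB_transpose_mul_indB (ℓ : ℕ) (M' : Fin (d + 1) → ℕ) :
    (indB (ℓ + 1) M')ᵀ * indB (ℓ + 1) M' = (((ℓ : ℝ) + 1) ^ (d + 1)) • blockAvgP ℓ M' := by
  ext y y'
  have hL : (((ℓ : ℝ) + 1) ^ (d + 1)) ≠ 0 := by positivity
  rw [Matrix.mul_apply, Matrix.smul_apply, smul_eq_mul]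
  simp only [indB, blockAvgP, Matrix.transpose_apply, Matrix.of_apply]
  by_cases h : blk (ℓ + 1) y.1 = blk (ℓ + 1) y'.1
  · rw [if_pos h, mul_inv_cancel₀ hL, Finset.sum_eq_single (cSite d ℓ M' y)]
    · simp [cSite, h]
    · intro z _ hz
      have : ¬ blk (ℓ + 1) y.1 = z.1 := fun e => hz (Subtype.ext e.symm)
      simp [this]
    · intro hh; exact absurd (Finset.mem_univ _) hh
  · rw [if_neg h, mul_zero]
    refine Finset.sum_eq_zero fun z _ => ?_
    by_cases h1 : blk (ℓ + 1) y.1 = z.1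
    · have h2 : ¬ blk (ℓ + 1) y'.1 = z.1 := fun e => h (h1.trans e.symm)
      simp [h1, h2]
    · simp [h1]

end Objects

/-! ## §2 `Δ^{(k)}(□,Ã) + aL⁻²P(Ã)` and its inverse `C^{(k)}(□,Ã)` on the box; the constant-field gauge forms -/

section Covariance

variable {d : ℕ}

variable (d) in
/-- **`Δ^{(k)}(□,Ã) + aL⁻²P(Ã)`** on the unit box ((I.2.32), [B4] (1.13)–(1.14)): `a_kI − a_k²Q_k(Ã)G_k(□,Ã)Q_k^*(Ã) +
aL⁻²Q^*(Ã)Q(Ã)` in the lineage's indicator-weight coordinates (`Q_k = n^{−(d+1)}avgA`, `Q_k^* = avgAᵀ`, `Q = L^{−(d+1)}avgU`,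
`Q^* = avgUᵀ`). [cite: Balaban1983RegularityDecay, (1.13)–(1.14) p. 573; Balaban1982Higgs2, (2.113) p. 581] -/
def Mop (F : OrthFlow ι) (κ : ℝ) (ℓ k : ℕ) (a₂ a m2 : ℝ) (M' : Fin (d + 1) → ℕ)
    (emb : ↥(boxDom (M2 ℓ M')) → ↥(Box d ℓ k (M2 ℓ M')))
    (Γ : ↥(boxDom (M2 ℓ M')) → ↥(Box d ℓ k (M2 ℓ M')) → List ↥(Box d ℓ k (M2 ℓ M')))
    (emb' : ↥(boxDom M') → ↥(Box d ℓ k (M2 ℓ M')))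
    (Γ' : ↥(boxDom M') → ↥(boxDom (M2 ℓ M')) → List ↥(Box d ℓ k (M2 ℓ M')))
    (A : ↥(Box d ℓ k (M2 ℓ M')) → ↥(Box d ℓ k (M2 ℓ M')) → ℝ) :
    Matrix (↥(boxDom (M2 ℓ M')) × ι) (↥(boxDom (M2 ℓ M')) × ι) ℝ :=
  B1.aSeq a ((ℓ : ℝ) + 1) k • (1 : Matrix _ _ ℝ)
    - (B1.aSeq a ((ℓ : ℝ) + 1) k ^ 2 * ((((ℓ + 1) ^ k : ℕ) : ℝ) ^ (d + 1))⁻¹)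
        • (avgA d F κ ℓ k (M2 ℓ M') emb Γ A * greenA d F κ ℓ k a m2 (M2 ℓ M') emb Γ A
            * (avgA d F κ ℓ k (M2 ℓ M') emb Γ A)ᵀ)
    + (a₂ / ((ℓ : ℝ) + 1) ^ 2 * ((((ℓ : ℝ) + 1) ^ (d + 1)))⁻¹)
        • ((avgU d F κ ℓ k M' emb' Γ' A)ᵀ * avgU d F κ ℓ k M' emb' Γ' A)

variable (d) in
/-- **`C^{(k)}(□,Ã) = (Δ^{(k)}(□,Ã) + aL⁻²P(Ã))⁻¹`** (nonsingular inverse; the true inverse under invertibility).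
[cite: Balaban1983RegularityDecay, (1.13) p. 573; Balaban1982Higgs2, (2.113) p. 581] -/
def Cop (F : OrthFlow ι) (κ : ℝ) (ℓ k : ℕ) (a₂ a m2 : ℝ) (M' : Fin (d + 1) → ℕ)
    (emb : ↥(boxDom (M2 ℓ M')) → ↥(Box d ℓ k (M2 ℓ M')))
    (Γ : ↥(boxDom (M2 ℓ M')) → ↥(Box d ℓ k (M2 ℓ M')) → List ↥(Box d ℓ k (M2 ℓ M')))
    (emb' : ↥(boxDom M') → ↥(Box d ℓ k (M2 ℓ M')))
    (Γ' : ↥(boxDom M') → ↥(boxDom (M2 ℓ M')) → List ↥(Box d ℓ k (M2 ℓ M')))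
    (A : ↥(Box d ℓ k (M2 ℓ M')) → ↥(Box d ℓ k (M2 ℓ M')) → ℝ) :
    Matrix (↥(boxDom (M2 ℓ M')) × ι) (↥(boxDom (M2 ℓ M')) × ι) ℝ :=
  (Mop d F κ ℓ k a₂ a m2 M' emb Γ emb' Γ' A)⁻¹

/-- **THE UNIT-LEVEL TRANSPORTER AT A CONSTANT FIELD IS A PURE GAUGE**: `U(A₀(Γ′_{z,y})) = 𝒢(emb′ z)𝒢(emb y)ᵀ` for
every contour system ending at the base points (path independence, «A₀(∂Σ) = 0»).
[cite: Balaban1982Higgs2, (2.71)–(2.72) p. 573] -/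
theorem transU_constBond (F : OrthFlow ι) (κ : ℝ) (ℓ k : ℕ) (M' : Fin (d + 1) → ℕ)
    {emb : ↥(boxDom (M2 ℓ M')) → ↥(Box d ℓ k (M2 ℓ M'))} {emb' : ↥(boxDom M') → ↥(Box d ℓ k (M2 ℓ M'))}
    {Γ' : ↥(boxDom M') → ↥(boxDom (M2 ℓ M')) → List ↥(Box d ℓ k (M2 ℓ M'))}
    (hend' : ∀ z y, blkWt (ℓ + 1) M' (M2 ℓ M') z y ≠ 0 → pathEnd (emb' z) (Γ' z y) = emb y)
    (A₀ : Fin (d + 1) → ℝ) {z : ↥(boxDom M')} {y : ↥(boxDom (M2 ℓ M'))} (hy : cSite d ℓ M' y = z) :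
    transU d F κ ℓ k M' emb' Γ' (constBond A₀ Subtype.val) z y
      = gaugeU d F κ ℓ k (M2 ℓ M') A₀ (emb' z) * (gaugeU d F κ ℓ k (M2 ℓ M') A₀ (emb y))ᵀ := by
  have hq : blkWt (ℓ + 1) M' (M2 ℓ M') z y ≠ 0 := by
    rw [blkWtU_eq_ite, if_pos hy.symm]; exact one_ne_zero
  dsimp only [transU, gaugeU]
  rw [fieldLink_constBond, transport_gauge (F.isGauge _), transport_one, Matrix.mul_one, hend' z y hq]

/-- **`Q(A₀) = ℋ′·Q·ℋᵀ` ONE LEVEL UP** (`ℋ′ = ⊕_z𝒢(emb′ z)`, `ℋ = ⊕_y𝒢(emb y)`).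
[cite: Balaban1982Higgs2, (2.71)–(2.72) p. 573] -/
theorem avgU_constBond (F : OrthFlow ι) (κ : ℝ) (ℓ k : ℕ) (M' : Fin (d + 1) → ℕ)
    {emb : ↥(boxDom (M2 ℓ M')) → ↥(Box d ℓ k (M2 ℓ M'))} {emb' : ↥(boxDom M') → ↥(Box d ℓ k (M2 ℓ M'))}
    {Γ' : ↥(boxDom M') → ↥(boxDom (M2 ℓ M')) → List ↥(Box d ℓ k (M2 ℓ M'))}
    (hend' : ∀ z y, blkWt (ℓ + 1) M' (M2 ℓ M') z y ≠ 0 → pathEnd (emb' z) (Γ' z y) = emb y)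
    (A₀ : Fin (d + 1) → ℝ) :
    avgU d F κ ℓ k M' emb' Γ' (constBond A₀ Subtype.val)
      = blockDiag (gaugeU d F κ ℓ k (M2 ℓ M') A₀ ∘ emb') * avgOneU ι d ℓ M'
          * (blockDiag (gaugeU d F κ ℓ k (M2 ℓ M') A₀ ∘ emb))ᵀ := by
  dsimp only [avgU, avgOneU]
  rw [← avgOp_gauge]
  refine avgOp_congr fun z y hq => ?_
  have hy : cSite d ℓ M' y = z := by
    by_contra h
    rw [blkWtU_eq_ite, if_neg (Ne.symm h)] at hq
    exact hq rfl
  rw [transU_constBond F κ ℓ k M' hend' A₀ hy, gaugeKer_apply, Matrix.mul_one]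
  rfl

/-! ### The constant-field form of `Δ^{(k)}(□,A₀) + aL⁻²P(A₀)`: the zero-field matrix of `B4BoxCov237` dressed with the gauge -/

/-- Kronecker bookkeeping: `(A ⊗ 1)(B ⊗ 1) = AB ⊗ 1`. [folklore] -/
private theorem kron_mul {X Y Z : Type*} [Fintype Y] (A : Matrix X Y ℝ) (B : Matrix Y Z ℝ) :
    (A ⊗ₖ (1 : Matrix ι ι ℝ)) * (B ⊗ₖ (1 : Matrix ι ι ℝ)) = (A * B) ⊗ₖ (1 : Matrix ι ι ℝ) := by
  rw [← Matrix.mul_kronecker_mul, Matrix.mul_one]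

omit [Fintype ι] in
/-- Kronecker bookkeeping: `(A ⊗ 1)ᵀ = Aᵀ ⊗ 1`. [folklore] -/
private theorem kron_transpose {X Y : Type*} (A : Matrix X Y ℝ) :
    (A ⊗ₖ (1 : Matrix ι ι ℝ))ᵀ = Aᵀ ⊗ₖ (1 : Matrix ι ι ℝ) := by
  rw [← Matrix.kroneckerMap_transpose, Matrix.transpose_one]

omit [Fintype ι] in
/-- Kronecker bookkeeping: `X ↦ X ⊗ 1` is linear. [folklore] -/
private theorem kron_lin {X : Type*} [DecidableEq X] (A B P : Matrix X X ℝ) (a b c : ℝ) :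
    a • (1 : Matrix (X × ι) (X × ι) ℝ) - b • (A ⊗ₖ (1 : Matrix ι ι ℝ)) + c • (P ⊗ₖ (1 : Matrix ι ι ℝ))
      = (a • (1 : Matrix X X ℝ) - b • A + c • P) ⊗ₖ (1 : Matrix ι ι ℝ) ∧
    (B ⊗ₖ (1 : Matrix ι ι ℝ)) = B ⊗ₖ 1 := by
  refine ⟨?_, rfl⟩
  ext ⟨x, i⟩ ⟨y, j⟩
  simp only [Matrix.add_apply, Matrix.sub_apply, Matrix.smul_apply, Matrix.kroneckerMap_apply, Matrix.one_apply,
    smul_eq_mul, Prod.mk.injEq]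
  by_cases hx : x = y <;> by_cases hi : i = j <;> simp [hx, hi]

/-- conjugation bookkeeping: `p·1 − q·ℋYℋᵀ + r·ℋZℋᵀ = ℋ(p·1 − q·Y + r·Z)ℋᵀ` when `ℋℋᵀ = 1`. [folklore] -/
private theorem conj_lin {m : Type*} [Fintype m] [DecidableEq m] {H : Matrix m m ℝ} (hHH : H * Hᵀ = 1) (Y Z : Matrix m m ℝ)
    (p q r : ℝ) : p • (1 : Matrix m m ℝ) - q • (H * Y * Hᵀ) + r • (H * Z * Hᵀ) = H * (p • 1 - q • Y + r • Z) * Hᵀ := by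
  rw [Matrix.mul_add, Matrix.mul_sub, Matrix.add_mul, Matrix.sub_mul, Matrix.mul_smul, Matrix.smul_mul,
    Matrix.mul_smul, Matrix.smul_mul, Matrix.mul_smul, Matrix.smul_mul, Matrix.mul_one, hHH]

/-- **`Δ^{(k)}(□,A₀) + aL⁻²P(A₀) = ℋ·((Δ^{(k)}(□) + aL⁻²P) ⊗ 1)·ℋᵀ`**: at a constant field the box operator is the ZERO-FIELD
matrix `B4BoxCov237.covOp` (Keff + (a/L²)·blockAvgP, PROVED positive and with exponentially decaying inverse there)
tensored with `1_N` and dressed with the gauge `ℋ = ⊕_y U(A₀(Γ_{·,y}))` — the content of «the constant field A₀ can be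
gauged out» for the covariance of (2.113). [cite: Balaban1982Higgs2, p. 572–573 (2.69)–(2.73), (2.113) p. 581;
Balaban1983RegularityDecay, (1.13)–(1.14) p. 573] -/
theorem Mop_constBond (F : OrthFlow ι) (κ : ℝ) {ℓ k : ℕ} (hℓ : 1 ≤ ℓ) (hk : 1 ≤ k) (a₂ : ℝ) {a m2 : ℝ} (ha : 0 < a)
    (hm : 0 ≤ m2) {M' : Fin (d + 1) → ℕ} (hM' : ∀ i, 1 ≤ M' i)
    {emb : ↥(boxDom (M2 ℓ M')) → ↥(Box d ℓ k (M2 ℓ M'))}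
    {Γ : ↥(boxDom (M2 ℓ M')) → ↥(Box d ℓ k (M2 ℓ M')) → List ↥(Box d ℓ k (M2 ℓ M'))}
    (hend : ∀ y x, blkWt ((ℓ + 1) ^ k) (M2 ℓ M') (fun i => (ℓ + 1) ^ k * M2 ℓ M' i) y x ≠ 0 →
      pathEnd (emb y) (Γ y x) = x)
    {emb' : ↥(boxDom M') → ↥(Box d ℓ k (M2 ℓ M'))}
    {Γ' : ↥(boxDom M') → ↥(boxDom (M2 ℓ M')) → List ↥(Box d ℓ k (M2 ℓ M'))}
    (hend' : ∀ z y, blkWt (ℓ + 1) M' (M2 ℓ M') z y ≠ 0 → pathEnd (emb' z) (Γ' z y) = emb y)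
    (A₀ : Fin (d + 1) → ℝ) :
    Mop d F κ ℓ k a₂ a m2 M' emb Γ emb' Γ' (constBond A₀ Subtype.val)
      = blockDiag (gaugeU d F κ ℓ k (M2 ℓ M') A₀ ∘ emb)
          * (B4BoxCov237.covOp ((ℓ + 1) ^ k) ℓ (B1.aSeq a ((ℓ : ℝ) + 1) k) a₂ m2 M' ⊗ₖ (1 : Matrix ι ι ℝ))
          * (blockDiag (gaugeU d F κ ℓ k (M2 ℓ M') A₀ ∘ emb))ᵀ := by
  have hM : ∀ i, 1 ≤ M2 ℓ M' i := fun i => Nat.one_le_iff_ne_zero.2 (Nat.mul_ne_zero (Nat.succ_ne_zero ℓ)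
    (Nat.one_le_iff_ne_zero.1 (hM' i)))
  set H := blockDiag (gaugeU d F κ ℓ k (M2 ℓ M') A₀ ∘ emb) with hH
  set H' := blockDiag (gaugeU d F κ ℓ k (M2 ℓ M') A₀ ∘ emb') with hH'
  set U := blockDiag (gaugeU d F κ ℓ k (M2 ℓ M') A₀) with hU
  have hUU : Uᵀ * U = 1 := blockDiag_transpose_mul_self (F.isGauge _)
  have hHH : H * Hᵀ = 1 := blockDiag_mul_transpose_self (F.isGauge _)
  have hH'H' : H'ᵀ * H' = 1 := blockDiag_transpose_mul_self (F.isGauge _)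
  have hQ : avgA d F κ ℓ k (M2 ℓ M') emb Γ (constBond A₀ Subtype.val) = H * avgOne ι d ℓ k (M2 ℓ M') * Uᵀ :=
    avgA_constBond F κ ℓ k (M2 ℓ M') hend A₀
  have hG : greenA d F κ ℓ k a m2 (M2 ℓ M') emb Γ (constBond A₀ Subtype.val)
      = U * (gk d ℓ k a m2 (M2 ℓ M') ⊗ₖ (1 : Matrix ι ι ℝ)) * Uᵀ :=
    greenA0_eq_gauge F κ hℓ hk ha hm hM hend A₀
  have hQU : avgU d F κ ℓ k M' emb' Γ' (constBond A₀ Subtype.val) = H' * avgOneU ι d ℓ M' * Hᵀ :=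
    avgU_constBond F κ ℓ k M' hend' A₀
  -- the two sandwiches
  have h2 : avgA d F κ ℓ k (M2 ℓ M') emb Γ (constBond A₀ Subtype.val)
        * greenA d F κ ℓ k a m2 (M2 ℓ M') emb Γ (constBond A₀ Subtype.val)
        * (avgA d F κ ℓ k (M2 ℓ M') emb Γ (constBond A₀ Subtype.val))ᵀ
      = H * ((indB ((ℓ + 1) ^ k) (M2 ℓ M') * gk d ℓ k a m2 (M2 ℓ M') * (indB ((ℓ + 1) ^ k) (M2 ℓ M'))ᵀ)
          ⊗ₖ (1 : Matrix ι ι ℝ)) * Hᵀ := by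
    rw [hQ, hG, avgOne_eq_kron]
    simp only [Matrix.transpose_mul, Matrix.transpose_transpose, kron_transpose, ← kron_mul, Matrix.mul_assoc]
    rw [← Matrix.mul_assoc Uᵀ U, hUU, Matrix.one_mul, ← Matrix.mul_assoc Uᵀ U, hUU, Matrix.one_mul]
  have h3 : (avgU d F κ ℓ k M' emb' Γ' (constBond A₀ Subtype.val))ᵀ
        * avgU d F κ ℓ k M' emb' Γ' (constBond A₀ Subtype.val)
      = H * (((indB (ℓ + 1) M')ᵀ * indB (ℓ + 1) M') ⊗ₖ (1 : Matrix ι ι ℝ)) * Hᵀ := by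
    rw [hQU, avgOneU_eq_kron]
    simp only [Matrix.transpose_mul, Matrix.transpose_transpose, kron_transpose, ← kron_mul, Matrix.mul_assoc]
    rw [← Matrix.mul_assoc H'ᵀ H', hH'H', Matrix.one_mul]
  unfold Mop
  rw [h2, h3, indB_transpose_mul_indB, conj_lin hHH, (kron_lin _ (1 : Matrix _ _ ℝ) _ _ _ _).1]
  unfold B4BoxCov237.covOp Keff
  rw [smul_smul, inv_mul_cancel_right₀ (by positivity : (((ℓ : ℝ) + 1) ^ (d + 1)) ≠ 0)]

/-- **`C^{(k)}(□,A₀) = ℋ·(C^{(k)}(□) ⊗ 1)·ℋᵀ`** — the unit-lattice covariance at a constant field is the gauge-dressed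
zero-field covariance (`C^{(k)}(□) = B4BoxCov237.covOp⁻¹`, exponentially decaying by `cov237_box_decay`); the analogue
for `C^{(k)}` of (2.73) «G_k(□,A₀;x,x′) = U(A₀(Γ_{x,y}))G_k(□,0;x,x′)U(A₀(Γ_{y,x′}))».
[cite: Balaban1982Higgs2, (2.73) p. 573, (2.113) p. 581; Balaban1983RegularityDecay, (1.13) p. 573] -/
theorem Cop_constBond (F : OrthFlow ι) (κ : ℝ) {ℓ k : ℕ} (hℓ : 1 ≤ ℓ) (hk : 1 ≤ k) (a₂ : ℝ) {a m2 : ℝ} (ha : 0 < a)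
    (hm : 0 ≤ m2) {M' : Fin (d + 1) → ℕ} (hM' : ∀ i, 1 ≤ M' i)
    {emb : ↥(boxDom (M2 ℓ M')) → ↥(Box d ℓ k (M2 ℓ M'))}
    {Γ : ↥(boxDom (M2 ℓ M')) → ↥(Box d ℓ k (M2 ℓ M')) → List ↥(Box d ℓ k (M2 ℓ M'))}
    (hend : ∀ y x, blkWt ((ℓ + 1) ^ k) (M2 ℓ M') (fun i => (ℓ + 1) ^ k * M2 ℓ M' i) y x ≠ 0 →
      pathEnd (emb y) (Γ y x) = x)
    {emb' : ↥(boxDom M') → ↥(Box d ℓ k (M2 ℓ M'))}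
    {Γ' : ↥(boxDom M') → ↥(boxDom (M2 ℓ M')) → List ↥(Box d ℓ k (M2 ℓ M'))}
    (hend' : ∀ z y, blkWt (ℓ + 1) M' (M2 ℓ M') z y ≠ 0 → pathEnd (emb' z) (Γ' z y) = emb y)
    (A₀ : Fin (d + 1) → ℝ)
    (hX : B4BoxCov237.covOp ((ℓ + 1) ^ k) ℓ (B1.aSeq a ((ℓ : ℝ) + 1) k) a₂ m2 M'
      * (B4BoxCov237.covOp ((ℓ + 1) ^ k) ℓ (B1.aSeq a ((ℓ : ℝ) + 1) k) a₂ m2 M')⁻¹ = 1) :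
    Cop d F κ ℓ k a₂ a m2 M' emb Γ emb' Γ' (constBond A₀ Subtype.val)
      = blockDiag (gaugeU d F κ ℓ k (M2 ℓ M') A₀ ∘ emb)
          * ((B4BoxCov237.covOp ((ℓ + 1) ^ k) ℓ (B1.aSeq a ((ℓ : ℝ) + 1) k) a₂ m2 M')⁻¹ ⊗ₖ (1 : Matrix ι ι ℝ))
          * (blockDiag (gaugeU d F κ ℓ k (M2 ℓ M') A₀ ∘ emb))ᵀ := by
  set H := blockDiag (gaugeU d F κ ℓ k (M2 ℓ M') A₀ ∘ emb) with hH
  set X := B4BoxCov237.covOp ((ℓ + 1) ^ k) ℓ (B1.aSeq a ((ℓ : ℝ) + 1) k) a₂ m2 M' with hXdef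
  have hHH : H * Hᵀ = 1 := blockDiag_mul_transpose_self (F.isGauge _)
  have hHtH : Hᵀ * H = 1 := blockDiag_transpose_mul_self (F.isGauge _)
  unfold Cop
  rw [Mop_constBond F κ hℓ hk a₂ ha hm hM' hend hend' A₀]
  refine Matrix.inv_eq_right_inv ?_
  calc H * (X ⊗ₖ (1 : Matrix ι ι ℝ)) * Hᵀ * (H * (X⁻¹ ⊗ₖ (1 : Matrix ι ι ℝ)) * Hᵀ)
      = H * ((X ⊗ₖ (1 : Matrix ι ι ℝ)) * (Hᵀ * H) * (X⁻¹ ⊗ₖ (1 : Matrix ι ι ℝ))) * Hᵀ := by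
        simp only [Matrix.mul_assoc]
    _ = 1 := by rw [hHtH, Matrix.mul_one, kron_mul, hX, Matrix.one_kronecker_one, Matrix.mul_one, hHH]

/-- `Δ^{(k)}(□,A₀) + aL⁻²P(A₀)` is invertible when the zero-field matrix is. [cite: Balaban1983RegularityDecay, (1.15) p. 574] -/
theorem isUnit_det_Mop_constBond (F : OrthFlow ι) (κ : ℝ) {ℓ k : ℕ} (hℓ : 1 ≤ ℓ) (hk : 1 ≤ k) (a₂ : ℝ) {a m2 : ℝ}
    (ha : 0 < a) (hm : 0 ≤ m2) {M' : Fin (d + 1) → ℕ} (hM' : ∀ i, 1 ≤ M' i)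
    {emb : ↥(boxDom (M2 ℓ M')) → ↥(Box d ℓ k (M2 ℓ M'))}
    {Γ : ↥(boxDom (M2 ℓ M')) → ↥(Box d ℓ k (M2 ℓ M')) → List ↥(Box d ℓ k (M2 ℓ M'))}
    (hend : ∀ y x, blkWt ((ℓ + 1) ^ k) (M2 ℓ M') (fun i => (ℓ + 1) ^ k * M2 ℓ M' i) y x ≠ 0 →
      pathEnd (emb y) (Γ y x) = x)
    {emb' : ↥(boxDom M') → ↥(Box d ℓ k (M2 ℓ M'))}
    {Γ' : ↥(boxDom M') → ↥(boxDom (M2 ℓ M')) → List ↥(Box d ℓ k (M2 ℓ M'))}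
    (hend' : ∀ z y, blkWt (ℓ + 1) M' (M2 ℓ M') z y ≠ 0 → pathEnd (emb' z) (Γ' z y) = emb y)
    (A₀ : Fin (d + 1) → ℝ)
    (hX : B4BoxCov237.covOp ((ℓ + 1) ^ k) ℓ (B1.aSeq a ((ℓ : ℝ) + 1) k) a₂ m2 M'
      * (B4BoxCov237.covOp ((ℓ + 1) ^ k) ℓ (B1.aSeq a ((ℓ : ℝ) + 1) k) a₂ m2 M')⁻¹ = 1) :
    IsUnit (Mop d F κ ℓ k a₂ a m2 M' emb Γ emb' Γ' (constBond A₀ Subtype.val)).det := by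
  set H := blockDiag (gaugeU d F κ ℓ k (M2 ℓ M') A₀ ∘ emb) with hH
  set X := B4BoxCov237.covOp ((ℓ + 1) ^ k) ℓ (B1.aSeq a ((ℓ : ℝ) + 1) k) a₂ m2 M' with hXdef
  have hHH : H * Hᵀ = 1 := blockDiag_mul_transpose_self (F.isGauge _)
  have hHtH : Hᵀ * H = 1 := blockDiag_transpose_mul_self (F.isGauge _)
  rw [Mop_constBond F κ hℓ hk a₂ ha hm hM' hend hend' A₀]
  refine Matrix.isUnit_det_of_right_inverse (B := H * (X⁻¹ ⊗ₖ (1 : Matrix ι ι ℝ)) * Hᵀ) ?_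
  calc H * (X ⊗ₖ (1 : Matrix ι ι ℝ)) * Hᵀ * (H * (X⁻¹ ⊗ₖ (1 : Matrix ι ι ℝ)) * Hᵀ)
      = H * ((X ⊗ₖ (1 : Matrix ι ι ℝ)) * (Hᵀ * H) * (X⁻¹ ⊗ₖ (1 : Matrix ι ι ℝ))) * Hᵀ := by
        simp only [Matrix.mul_assoc]
    _ = 1 := by rw [hHtH, Matrix.mul_one, kron_mul, hX, Matrix.one_kronecker_one, Matrix.mul_one, hHH]

/-! ### The value `aL⁻²C^{(k)}(□)1` of (2.83)–(2.85), EXACT on the box -/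

/-- `indBᵀ1 = 1`: every fine point lies in exactly one block ((1.1) «The lattice ηZ^d is divided into unit cubes called
blocks»). [cite: Balaban1983RegularityDecay, (1.1) p. 572] -/
theorem indB_transpose_mulVec_one {n : ℕ} (hn : 1 ≤ n) (M : Fin (d + 1) → ℕ) :
    (indB n M)ᵀ *ᵥ (fun _ => (1 : ℝ)) = fun _ => 1 := by
  funext x
  rw [mulVec, dotProduct]
  simp only [Matrix.transpose_apply, mul_one]
  rw [Finset.sum_eq_single (⟨blk n x.1, blk_mem_boxDom hn x.2⟩ : ↥(boxDom M))]
  · simp [indB]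
  · intro y _ hy
    have : ¬ blk n x.1 = y.1 := fun e => hy (Subtype.ext e.symm)
    simp [indB, this]
  · intro h; exact absurd (Finset.mem_univ _) h

/-- `indB·1 = n^{d+1}·1`: a block has `n^{d+1}` fine points ((1.1)). [cite: Balaban1983RegularityDecay, (1.1) p. 572] -/
theorem indB_mulVec_one {n : ℕ} (hn : 1 ≤ n) (M : Fin (d + 1) → ℕ) :
    indB n M *ᵥ (fun _ => (1 : ℝ)) = fun _ => ((n : ℝ) ^ (d + 1)) := by
  funext y
  rw [B4BoxCov237.indB_mulVec, Finset.sum_const, card_filter_blk hn M y, nsmul_eq_mul, mul_one]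
  push_cast
  rfl

/-- `(boxOpR)⁻¹·1 = (m² + a)⁻¹·1` (the Neumann Laplacian kills constants; (2.75)/(2.84) «a_kG_k(□,0)Q_k^*1 = a_k/(a_k + m²)»).
[cite: Balaban1982Higgs2, (2.75) p. 573, (2.84) p. 575] -/
theorem boxOpR_inv_mulVec_one {n : ℕ} (hn : 1 ≤ n) {a m2 : ℝ} (ha : 0 < a) (hm : 0 ≤ m2)
    {M : Fin (d + 1) → ℕ} (hM : ∀ i, 1 ≤ M i) :
    (boxOpR n a m2 M)⁻¹ *ᵥ (fun _ => (1 : ℝ)) = fun _ => (m2 + a)⁻¹ := by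
  have hdet := boxOpR_det_isUnit hn ha hm hM
  have h1 : boxOpR n a m2 M *ᵥ (fun _ => (1 : ℝ)) = (m2 + a) • (fun _ => (1 : ℝ)) := by
    funext x
    rw [boxOpR_mulVec_one hn, Pi.smul_apply, smul_eq_mul, mul_one]
  have hma : m2 + a ≠ 0 := by positivity
  calc (boxOpR n a m2 M)⁻¹ *ᵥ (fun _ => (1 : ℝ))
      = (boxOpR n a m2 M)⁻¹ *ᵥ ((m2 + a)⁻¹ • (boxOpR n a m2 M *ᵥ fun _ => (1 : ℝ))) := by
        rw [h1, smul_smul, inv_mul_cancel₀ hma, one_smul]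
    _ = fun _ => (m2 + a)⁻¹ := by
        rw [mulVec_smul, mulVec_mulVec, Matrix.nonsing_inv_mul _ hdet, one_mulVec]
        funext x; simp

/-- **(2.83)–(2.84) on the box**: `Δ^{(k)}(□)1 = (a_km²/(a_k + m²))·1`. [cite: Balaban1982Higgs2, (2.83)–(2.84) p. 575] -/
theorem Keff_mulVec_one {n : ℕ} (hn : 1 ≤ n) {a m2 : ℝ} (ha : 0 < a) (hm : 0 ≤ m2)
    {M : Fin (d + 1) → ℕ} (hM : ∀ i, 1 ≤ M i) :
    Keff n a m2 M *ᵥ (fun _ => (1 : ℝ)) = fun _ => a * m2 / (a + m2) := by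
  have hn0 : ((n : ℝ) ^ (d + 1)) ≠ 0 := by
    have : (1 : ℝ) ≤ n := by exact_mod_cast hn
    positivity
  have hma : a + m2 ≠ 0 := by positivity
  unfold Keff
  rw [sub_mulVec, smul_mulVec, one_mulVec, smul_mulVec, ← mulVec_mulVec, ← mulVec_mulVec,
    indB_transpose_mulVec_one hn, boxOpR_inv_mulVec_one hn ha hm hM]
  have h2 : indB n M *ᵥ (fun _ => (m2 + a)⁻¹) = fun _ => ((n : ℝ) ^ (d + 1)) * (m2 + a)⁻¹ := by
    have : (fun _ : ↥(boxDom (fun i => n * M i)) => (m2 + a)⁻¹) = (m2 + a)⁻¹ • (fun _ => (1 : ℝ)) := by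
      funext x; simp
    rw [this, mulVec_smul, indB_mulVec_one hn]
    funext y; simp [mul_comm]
  rw [h2]
  funext y
  simp only [Pi.sub_apply, Pi.smul_apply, smul_eq_mul, mul_one]
  rw [add_comm m2 a]
  field_simp
  ring

/-- `P1 = 1`: an `L`-block has `L^{d+1}` unit sites. [cite: Balaban1983RegularityDecay, (1.13) p. 573] -/
theorem blockAvgP_mulVec_one (ℓ : ℕ) (M' : Fin (d + 1) → ℕ) :
    blockAvgP ℓ M' *ᵥ (fun _ => (1 : ℝ)) = fun _ => 1 := by
  have hL : (((ℓ : ℝ) + 1) ^ (d + 1)) ≠ 0 := by positivity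
  funext y
  rw [mulVec, dotProduct]
  simp only [blockAvgP, Matrix.of_apply, mul_one]
  rw [← Finset.sum_filter, Finset.sum_const, nsmul_eq_mul]
  have hc : (Finset.univ.filter (fun y' : ↥(boxDom (fun i => (ℓ + 1) * M' i)) =>
      blk (ℓ + 1) y.1 = blk (ℓ + 1) y'.1)).card = (ℓ + 1) ^ (d + 1) := by
    rw [← B4BoxCov237.card_filter_lblk ℓ M' (B4BoxCov237.lblk ℓ M' y)]
    congr 1
    refine Finset.filter_congr fun y' _ => ?_
    simp only [B4BoxCov237.lblk, Subtype.ext_iff]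
    exact eq_comm
  rw [hc]
  push_cast
  exact mul_inv_cancel₀ hL

/-- **(2.83): `(Δ^{(k)}(□) + aL⁻²P)1 = (a_km²/(a_k+m²) + aL⁻²)·1`**. [cite: Balaban1982Higgs2, (2.83)–(2.84) p. 575] -/
theorem covOp_mulVec_one {n : ℕ} (hn : 1 ≤ n) (ℓ : ℕ) {a₁ m2 : ℝ} (ha : 0 < a₁) (hm : 0 ≤ m2) (a₂ : ℝ)
    {M' : Fin (d + 1) → ℕ} (hM' : ∀ i, 1 ≤ M' i) :
    B4BoxCov237.covOp n ℓ a₁ a₂ m2 M' *ᵥ (fun _ => (1 : ℝ))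
      = fun _ => a₁ * m2 / (a₁ + m2) + a₂ / ((ℓ : ℝ) + 1) ^ 2 := by
  have hM : ∀ i, 1 ≤ (ℓ + 1) * M' i := fun i => Nat.one_le_iff_ne_zero.2 (Nat.mul_ne_zero (Nat.succ_ne_zero ℓ)
    (Nat.one_le_iff_ne_zero.1 (hM' i)))
  unfold B4BoxCov237.covOp
  rw [add_mulVec, smul_mulVec, Keff_mulVec_one hn ha hm hM, blockAvgP_mulVec_one]
  funext y
  simp

/-- **(2.85) ON THE BOX, EXACT**: `aL⁻²Σ_{y′}C^{(k)}(□; y, y′) = aL⁻²/(aL⁻² + a_km²/(a_k + m²)) = (1 + a⁻¹L²a_km²/(a_k + m²))⁻¹`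
(«aL⁻²C^{(k)}1 = (1 + a⁻¹L²a_kμ₀²(L^kε)²/(a_k + μ₀²(L^kε)²))⁻¹ = 1 + O(μ₀²(L^kε)²)»; the last form and its bound are
r14's `B2StepK.display285`/`display285_bound`). [cite: Balaban1982Higgs2, (2.85) p. 575] -/
theorem covOp_inv_rowsum {n : ℕ} (hn : 1 ≤ n) (ℓ : ℕ) {a₁ m2 a₂ : ℝ} (ha : 0 < a₁) (hm : 0 ≤ m2) (ha₂ : 0 < a₂)
    {M' : Fin (d + 1) → ℕ} (hM' : ∀ i, 1 ≤ M' i)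
    (hX : IsUnit (B4BoxCov237.covOp n ℓ a₁ a₂ m2 M').det) (y : ↥(boxDom (M2 ℓ M'))) :
    a₂ / ((ℓ : ℝ) + 1) ^ 2 * ∑ y', (B4BoxCov237.covOp n ℓ a₁ a₂ m2 M')⁻¹ y y'
      = (a₂ / ((ℓ : ℝ) + 1) ^ 2) / (a₂ / ((ℓ : ℝ) + 1) ^ 2 + a₁ * m2 / (a₁ + m2)) := by
  set c : ℝ := a₁ * m2 / (a₁ + m2) + a₂ / ((ℓ : ℝ) + 1) ^ 2 with hc
  have hcpos : 0 < c := by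
    have : 0 ≤ a₁ * m2 / (a₁ + m2) := by positivity
    have : 0 < a₂ / ((ℓ : ℝ) + 1) ^ 2 := by positivity
    linarith
  have h1 : (B4BoxCov237.covOp n ℓ a₁ a₂ m2 M')⁻¹ *ᵥ (fun _ => (1 : ℝ)) = fun _ => c⁻¹ := by
    have hone : (fun _ : ↥(boxDom (fun i => (ℓ + 1) * M' i)) => (1 : ℝ))
        = c⁻¹ • (B4BoxCov237.covOp n ℓ a₁ a₂ m2 M' *ᵥ fun _ => (1 : ℝ)) := by
      rw [covOp_mulVec_one hn ℓ ha hm a₂ hM']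
      funext x
      simp only [Pi.smul_apply, smul_eq_mul]
      rw [← hc, inv_mul_cancel₀ hcpos.ne']
    rw [hone, mulVec_smul, mulVec_mulVec, Matrix.nonsing_inv_mul _ hX, one_mulVec]
    funext x; simp
  have h2 : ∑ y', (B4BoxCov237.covOp n ℓ a₁ a₂ m2 M')⁻¹ y y' = c⁻¹ := by
    have := congrFun h1 y
    simp only [mulVec, dotProduct, mul_one] at this
    exact this
  rw [h2, div_eq_mul_inv _ (a₂ / ((ℓ : ℝ) + 1) ^ 2 + _), hc, add_comm (a₁ * m2 / (a₁ + m2))]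

end Covariance

/-! ## §3 Sup-norm tools: block averages, transporters, the gauge, Kronecker kernels -/

section Norms

variable {d : ℕ}

omit [Fintype ι] [DecidableEq ι] in
/-- `A(Γ) = Σ_{b⊂Γ}A_b` is additive in the field ((1.4) «A(Γ) = Σ_{b⊂Γ} A_b»). [cite: Balaban1983RegularityDecay, (1.4) p. 572] -/
theorem lsum_add {X : Type*} (A B : X → X → ℝ) (x : X) (l : List X) : lsum (A + B) x l = lsum A x l + lsum B x l := by
  induction l generalizing x with
  | nil => simp [lsum]
  | cons y l ih => simp only [lsum, ih, Pi.add_apply]; ring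

omit [Fintype ι] [DecidableEq ι] in
/-- block averages (1.4) are linear in the transporters. [cite: Balaban1983RegularityDecay, (1.4) p. 572] -/
theorem avgOp_sub {X Y : Type*} (q : Y → X → ℝ) (T T' : Y → X → Matrix ι ι ℝ) :
    avgOp q T - avgOp q T' = avgOp q (fun y x => T y x - T' y x) := by
  ext ⟨y, i⟩ ⟨x, j⟩
  simp [avgOp, blockOp, Matrix.sub_apply, mul_sub]

omit [DecidableEq ι] in
/-- a block-average row: `|(Q w)(y)| ≤ Σ_x |q(y,x)|·|T(y,x)w(x)|`. [cite: Balaban1983RegularityDecay, (1.4) p. 572] -/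
theorem siteNorm_fld_avgOp_le {X Y : Type*} [Fintype X] (q : Y → X → ℝ) (T : Y → X → Matrix ι ι ℝ)
    (w : X × ι → ℝ) (y : Y) :
    siteNorm (fld (avgOp q T *ᵥ w) y) ≤ ∑ x, |q y x| * siteNorm (T y x *ᵥ fld w x) := by
  rw [fld_avgOp_mulVec]
  refine (siteNorm_sum_le _ _).trans (Finset.sum_le_sum fun x _ => ?_)
  rw [siteNorm_smul]

/-- the flow step: `|(U(s+t) − U(s))u| ≤ ℓ₁|t|·|u|`. [cite: Balaban1983RegularityDecay, p. 580 «F_{1,k}(A′)»] -/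
theorem siteNorm_flow_add_sub_le (F : OrthFlow ι) {ℓ₁ : ℝ} (hℓ₁ : 0 ≤ ℓ₁)
    (hLip : ∀ t (v : ι → ℝ), ((F.U t - 1) *ᵥ v) ⬝ᵥ ((F.U t - 1) *ᵥ v) ≤ (ℓ₁ * t) ^ 2 * (v ⬝ᵥ v))
    (s t : ℝ) (u : ι → ℝ) : siteNorm ((F.U (s + t) - F.U s) *ᵥ u) ≤ ℓ₁ * |t| * siteNorm u := by
  have h : F.U (s + t) - F.U s = F.U s * (F.U t - 1) := by rw [F.map_add, Matrix.mul_sub, Matrix.mul_one]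
  rw [h, ← mulVec_mulVec, siteNorm_flow]
  exact siteNorm_flow_sub_one_le F hℓ₁ hLip t u

/-- … and for the transposes: `|(U(s+t) − U(s))ᵀu| ≤ ℓ₁|t|·|u|`. [cite: Balaban1983RegularityDecay, p. 580] -/
theorem siteNorm_flow_add_sub_transpose_le (F : OrthFlow ι) {ℓ₁ : ℝ} (hℓ₁ : 0 ≤ ℓ₁)
    (hLip : ∀ t (v : ι → ℝ), ((F.U t - 1) *ᵥ v) ⬝ᵥ ((F.U t - 1) *ᵥ v) ≤ (ℓ₁ * t) ^ 2 * (v ⬝ᵥ v))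
    (s t : ℝ) (u : ι → ℝ) : siteNorm ((F.U (s + t) - F.U s)ᵀ *ᵥ u) ≤ ℓ₁ * |t| * siteNorm u := by
  rw [Matrix.transpose_sub, F.transpose_eq, F.transpose_eq, show -(s + t) = -s + -t by ring]
  simpa [abs_neg] using siteNorm_flow_add_sub_le F hℓ₁ hLip (-s) (-t) u

/-- **`|(avgA(Ã)w)(y)| ≤ n^{d+1}‖w‖_∞`** (a block has `n^{d+1}` points; transporters are orthogonal).
[cite: Balaban1983RegularityDecay, (1.4) p. 572] -/
theorem avgA_site_le (F : OrthFlow ι) (κ : ℝ) {ℓ : ℕ} (k : ℕ) (M : Fin (d + 1) → ℕ)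
    (emb : ↥(boxDom M) → ↥(Box d ℓ k M)) (Γ : ↥(boxDom M) → ↥(Box d ℓ k M) → List ↥(Box d ℓ k M))
    (A : ↥(Box d ℓ k M) → ↥(Box d ℓ k M) → ℝ) (w : ↥(Box d ℓ k M) × ι → ℝ) (y : ↥(boxDom M)) :
    siteNorm (fld (avgA d F κ ℓ k M emb Γ A *ᵥ w) y) ≤ ((((ℓ + 1) ^ k : ℕ) : ℝ) ^ (d + 1)) * supN w := by
  have hn : 1 ≤ (ℓ + 1) ^ k := Nat.one_le_pow _ _ (Nat.succ_pos ℓ)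
  refine (siteNorm_fld_avgOp_le _ _ _ _).trans ?_
  calc ∑ x, |blkWt ((ℓ + 1) ^ k) M (fun i => (ℓ + 1) ^ k * M i) y x|
        * siteNorm (contourTrans (fieldLink F κ A) emb Γ y x *ᵥ fld w x)
      ≤ ∑ x, blkWt ((ℓ + 1) ^ k) M (fun i => (ℓ + 1) ^ k * M i) y x * supN w := by
        refine Finset.sum_le_sum fun x _ => ?_
        rw [abs_of_nonneg (blkWt_nonneg _ _ _ _ _), contourTrans_fieldLink, siteNorm_flow]
        exact mul_le_mul_of_nonneg_left (le_supN w x) (blkWt_nonneg _ _ _ _ _)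
    _ ≤ ((((ℓ + 1) ^ k : ℕ) : ℝ) ^ (d + 1)) * supN w := by
        rw [← Finset.sum_mul]
        exact mul_le_mul_of_nonneg_right (by exact_mod_cast sum_blkWt_row hn M y) (supN_nonneg _)

/-- **`|((avgA(A₀+A′) − avgA(A₀))w)(y)| ≤ n^{d+1}ℓ₁τ‖w‖_∞`** when the `A′`-holonomies of the block contours are `≤ τ`
(«|Q_k(A₀) − Q_k(A^{(k)})| = O(p r)», (2.73)). [cite: Balaban1982Higgs2, (2.73) p. 573] -/
theorem avgA_sub_site_le (F : OrthFlow ι) {ℓ₁ : ℝ} (hℓ₁ : 0 ≤ ℓ₁)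
    (hLip : ∀ t (v : ι → ℝ), ((F.U t - 1) *ᵥ v) ⬝ᵥ ((F.U t - 1) *ᵥ v) ≤ (ℓ₁ * t) ^ 2 * (v ⬝ᵥ v))
    (κ : ℝ) {ℓ : ℕ} (k : ℕ) (M : Fin (d + 1) → ℕ)
    (emb : ↥(boxDom M) → ↥(Box d ℓ k M)) (Γ : ↥(boxDom M) → ↥(Box d ℓ k M) → List ↥(Box d ℓ k M))
    (A₀b A' : ↥(Box d ℓ k M) → ↥(Box d ℓ k M) → ℝ) {τ : ℝ} (hτ : 0 ≤ τ)
    (hτA : ∀ y x, blkWt ((ℓ + 1) ^ k) M (fun i => (ℓ + 1) ^ k * M i) y x ≠ 0 → |κ * lsum A' (emb y) (Γ y x)| ≤ τ)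
    (w : ↥(Box d ℓ k M) × ι → ℝ) (y : ↥(boxDom M)) :
    siteNorm (fld ((avgA d F κ ℓ k M emb Γ (A₀b + A') - avgA d F κ ℓ k M emb Γ A₀b) *ᵥ w) y)
      ≤ ((((ℓ + 1) ^ k : ℕ) : ℝ) ^ (d + 1)) * (ℓ₁ * τ) * supN w := by
  have hn : 1 ≤ (ℓ + 1) ^ k := Nat.one_le_pow _ _ (Nat.succ_pos ℓ)
  dsimp only [avgA]
  rw [avgOp_sub]
  refine (siteNorm_fld_avgOp_le _ _ _ _).trans ?_
  calc ∑ x, |blkWt ((ℓ + 1) ^ k) M (fun i => (ℓ + 1) ^ k * M i) y x|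
        * siteNorm ((contourTrans (fieldLink F κ (A₀b + A')) emb Γ y x - contourTrans (fieldLink F κ A₀b) emb Γ y x)
            *ᵥ fld w x)
      ≤ ∑ x, blkWt ((ℓ + 1) ^ k) M (fun i => (ℓ + 1) ^ k * M i) y x * ((ℓ₁ * τ) * supN w) := by
        refine Finset.sum_le_sum fun x _ => ?_
        rw [abs_of_nonneg (blkWt_nonneg _ _ _ _ _)]
        by_cases hq : blkWt ((ℓ + 1) ^ k) M (fun i => (ℓ + 1) ^ k * M i) y x = 0
        · rw [hq, zero_mul, zero_mul]
        refine mul_le_mul_of_nonneg_left ?_ (blkWt_nonneg _ _ _ _ _)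
        rw [contourTrans_fieldLink, contourTrans_fieldLink, lsum_add, mul_add]
        refine (siteNorm_flow_add_sub_le F hℓ₁ hLip _ _ _).trans ?_
        exact mul_le_mul (mul_le_mul_of_nonneg_left (hτA y x hq) hℓ₁) (le_supN w x) (siteNorm_nonneg _)
          (mul_nonneg hℓ₁ hτ)
    _ ≤ ((((ℓ + 1) ^ k : ℕ) : ℝ) ^ (d + 1)) * (ℓ₁ * τ) * supN w := by
        rw [← Finset.sum_mul, mul_assoc (((((ℓ + 1) ^ k : ℕ) : ℝ) ^ (d + 1)))]
        exact mul_le_mul_of_nonneg_right (by exact_mod_cast sum_blkWt_row hn M y)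
          (mul_nonneg (mul_nonneg hℓ₁ hτ) (supN_nonneg _))

/-- **`|(avgU(Ã)w)(z)| ≤ L^{d+1}‖w‖_∞`** (unit level). [cite: Balaban1983RegularityDecay, (1.13) p. 573] -/
theorem avgU_site_le (F : OrthFlow ι) (κ : ℝ) (ℓ k : ℕ) (M' : Fin (d + 1) → ℕ)
    (emb' : ↥(boxDom M') → ↥(Box d ℓ k (M2 ℓ M')))
    (Γ' : ↥(boxDom M') → ↥(boxDom (M2 ℓ M')) → List ↥(Box d ℓ k (M2 ℓ M')))
    (A : ↥(Box d ℓ k (M2 ℓ M')) → ↥(Box d ℓ k (M2 ℓ M')) → ℝ) (w : ↥(boxDom (M2 ℓ M')) × ι → ℝ)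
    (z : ↥(boxDom M')) :
    siteNorm (fld (avgU d F κ ℓ k M' emb' Γ' A *ᵥ w) z) ≤ (((ℓ : ℝ) + 1) ^ (d + 1)) * supN w := by
  dsimp only [avgU]
  refine (siteNorm_fld_avgOp_le _ _ _ _).trans ?_
  calc ∑ y, |blkWt (ℓ + 1) M' (M2 ℓ M') z y| * siteNorm (transU d F κ ℓ k M' emb' Γ' A z y *ᵥ fld w y)
      ≤ ∑ y, blkWt (ℓ + 1) M' (M2 ℓ M') z y * supN w := by
        refine Finset.sum_le_sum fun y _ => ?_
        rw [abs_of_nonneg (blkWt_nonneg _ _ _ _ _), transU, transport_fieldLink, siteNorm_flow]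
        exact mul_le_mul_of_nonneg_left (le_supN w y) (blkWt_nonneg _ _ _ _ _)
    _ ≤ (((ℓ : ℝ) + 1) ^ (d + 1)) * supN w := by
        rw [← Finset.sum_mul]
        refine mul_le_mul_of_nonneg_right ?_ (supN_nonneg _)
        exact_mod_cast sum_blkWt_row (n := ℓ + 1) (by omega) M' z

/-- **`|((avgU(A₀+A′) − avgU(A₀))w)(z)| ≤ L^{d+1}ℓ₁τ′‖w‖_∞`** when the `A′`-holonomies of the unit-level contours are `≤ τ′`.
[cite: Balaban1982Higgs2, (2.73) p. 573, (2.113) p. 581] -/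
theorem avgU_sub_site_le (F : OrthFlow ι) {ℓ₁ : ℝ} (hℓ₁ : 0 ≤ ℓ₁)
    (hLip : ∀ t (v : ι → ℝ), ((F.U t - 1) *ᵥ v) ⬝ᵥ ((F.U t - 1) *ᵥ v) ≤ (ℓ₁ * t) ^ 2 * (v ⬝ᵥ v))
    (κ : ℝ) (ℓ k : ℕ) (M' : Fin (d + 1) → ℕ)
    (emb' : ↥(boxDom M') → ↥(Box d ℓ k (M2 ℓ M')))
    (Γ' : ↥(boxDom M') → ↥(boxDom (M2 ℓ M')) → List ↥(Box d ℓ k (M2 ℓ M')))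
    (A₀b A' : ↥(Box d ℓ k (M2 ℓ M')) → ↥(Box d ℓ k (M2 ℓ M')) → ℝ) {τ' : ℝ} (hτ' : 0 ≤ τ')
    (hτA' : ∀ z y, blkWt (ℓ + 1) M' (M2 ℓ M') z y ≠ 0 → |κ * lsum A' (emb' z) (Γ' z y)| ≤ τ')
    (w : ↥(boxDom (M2 ℓ M')) × ι → ℝ) (z : ↥(boxDom M')) :
    siteNorm (fld ((avgU d F κ ℓ k M' emb' Γ' (A₀b + A') - avgU d F κ ℓ k M' emb' Γ' A₀b) *ᵥ w) z)
      ≤ (((ℓ : ℝ) + 1) ^ (d + 1)) * (ℓ₁ * τ') * supN w := by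
  dsimp only [avgU]
  rw [avgOp_sub]
  refine (siteNorm_fld_avgOp_le _ _ _ _).trans ?_
  calc ∑ y, |blkWt (ℓ + 1) M' (M2 ℓ M') z y|
        * siteNorm ((transU d F κ ℓ k M' emb' Γ' (A₀b + A') z y - transU d F κ ℓ k M' emb' Γ' A₀b z y)
            *ᵥ fld w y)
      ≤ ∑ y, blkWt (ℓ + 1) M' (M2 ℓ M') z y * ((ℓ₁ * τ') * supN w) := by
        refine Finset.sum_le_sum fun y _ => ?_
        rw [abs_of_nonneg (blkWt_nonneg _ _ _ _ _)]
        by_cases hq : blkWt (ℓ + 1) M' (M2 ℓ M') z y = 0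
        · rw [hq, zero_mul, zero_mul]
        refine mul_le_mul_of_nonneg_left ?_ (blkWt_nonneg _ _ _ _ _)
        simp only [transU]
        rw [transport_fieldLink, transport_fieldLink, lsum_add, mul_add]
        refine (siteNorm_flow_add_sub_le F hℓ₁ hLip _ _ _).trans ?_
        exact mul_le_mul (mul_le_mul_of_nonneg_left (hτA' z y hq) hℓ₁) (le_supN w y) (siteNorm_nonneg _)
          (mul_nonneg hℓ₁ hτ')
    _ ≤ (((ℓ : ℝ) + 1) ^ (d + 1)) * (ℓ₁ * τ') * supN w := by
        rw [← Finset.sum_mul, mul_assoc (((ℓ : ℝ) + 1) ^ (d + 1))]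
        refine mul_le_mul_of_nonneg_right ?_ (mul_nonneg (mul_nonneg hℓ₁ hτ') (supN_nonneg _))
        exact_mod_cast sum_blkWt_row (n := ℓ + 1) (by omega) M' z

/-- **`|(Q^*(Ã)ψ)(y)| ≤ ‖ψ‖_∞`** (one orthogonal transporter). [cite: Balaban1982Higgs2, (2.113) p. 581] -/
theorem avgUT_site_le (F : OrthFlow ι) (κ : ℝ) (ℓ k : ℕ) (M' : Fin (d + 1) → ℕ)
    (emb' : ↥(boxDom M') → ↥(Box d ℓ k (M2 ℓ M')))
    (Γ' : ↥(boxDom M') → ↥(boxDom (M2 ℓ M')) → List ↥(Box d ℓ k (M2 ℓ M')))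
    (A : ↥(Box d ℓ k (M2 ℓ M')) → ↥(Box d ℓ k (M2 ℓ M')) → ℝ) (ψ : ↥(boxDom M') × ι → ℝ)
    (y : ↥(boxDom (M2 ℓ M'))) :
    siteNorm (fld ((avgU d F κ ℓ k M' emb' Γ' A)ᵀ *ᵥ ψ) y) ≤ supN ψ := by
  rw [fld_avgU_transpose, transU, transport_fieldLink, F.transpose_eq, siteNorm_flow]
  exact le_supN ψ _

/-- **`|((Q^*(A₀+A′) − Q^*(A₀))ψ)(y)| ≤ ℓ₁τ′‖ψ‖_∞`**. [cite: Balaban1982Higgs2, (2.73) p. 573, (2.113) p. 581] -/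
theorem avgUT_sub_site_le (F : OrthFlow ι) {ℓ₁ : ℝ} (hℓ₁ : 0 ≤ ℓ₁)
    (hLip : ∀ t (v : ι → ℝ), ((F.U t - 1) *ᵥ v) ⬝ᵥ ((F.U t - 1) *ᵥ v) ≤ (ℓ₁ * t) ^ 2 * (v ⬝ᵥ v))
    (κ : ℝ) (ℓ k : ℕ) (M' : Fin (d + 1) → ℕ)
    (emb' : ↥(boxDom M') → ↥(Box d ℓ k (M2 ℓ M')))
    (Γ' : ↥(boxDom M') → ↥(boxDom (M2 ℓ M')) → List ↥(Box d ℓ k (M2 ℓ M')))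
    (A₀b A' : ↥(Box d ℓ k (M2 ℓ M')) → ↥(Box d ℓ k (M2 ℓ M')) → ℝ) {τ' : ℝ} (hτ' : 0 ≤ τ')
    (hτA' : ∀ z y, blkWt (ℓ + 1) M' (M2 ℓ M') z y ≠ 0 → |κ * lsum A' (emb' z) (Γ' z y)| ≤ τ')
    (ψ : ↥(boxDom M') × ι → ℝ) (y : ↥(boxDom (M2 ℓ M'))) :
    siteNorm (fld (((avgU d F κ ℓ k M' emb' Γ' (A₀b + A'))ᵀ - (avgU d F κ ℓ k M' emb' Γ' A₀b)ᵀ) *ᵥ ψ) y)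
      ≤ ℓ₁ * τ' * supN ψ := by
  have hq : blkWt (ℓ + 1) M' (M2 ℓ M') (cSite d ℓ M' y) y ≠ 0 := by
    rw [blkWtU_eq_ite, if_pos rfl]; exact one_ne_zero
  rw [sub_mulVec, fld_sub, fld_avgU_transpose, fld_avgU_transpose, ← sub_mulVec, ← Matrix.transpose_sub]
  simp only [transU]
  rw [transport_fieldLink, transport_fieldLink, lsum_add, mul_add]
  refine (siteNorm_flow_add_sub_transpose_le F hℓ₁ hLip _ _ _).trans ?_
  exact mul_le_mul (mul_le_mul_of_nonneg_left (hτA' _ y hq) hℓ₁) (le_supN ψ _) (siteNorm_nonneg _)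
    (mul_nonneg hℓ₁ hτ')

omit [DecidableEq ι] in
/-- **A KRONECKER KERNEL ACTS ROW-WISE**: `|((S ⊗ 1)Φ)(y)| ≤ (Σ_x|S(y,x)|)·‖Φ‖_∞` (the one-component propagator «G_k(□)1»
of [B4] p. 582 acting on vector fields). [cite: Balaban1983RegularityDecay, p. 582 «G_k(□, 0) = G_k(□)1»] -/
theorem kron_site_le [DecidableEq ι] {X Y : Type*} [Fintype X] (S : Matrix Y X ℝ) (Φ : X × ι → ℝ) (y : Y) :
    siteNorm (fld ((S ⊗ₖ (1 : Matrix ι ι ℝ)) *ᵥ Φ) y) ≤ (∑ x, |S y x|) * supN Φ := by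
  rw [fld_kron_mulVec, Finset.sum_mul]
  refine (siteNorm_sum_le _ _).trans (Finset.sum_le_sum fun x _ => ?_)
  rw [siteNorm_smul]
  exact mul_le_mul_of_nonneg_left (le_supN Φ x) (abs_nonneg _)

/-- the gauge does not change site norms: `|(ℋv)(y)| = |v(y)|`. [cite: Balaban1982Higgs2, p. 573] -/
theorem siteNorm_fld_blockDiag_gaugeU {Y : Type*} [Fintype Y] [DecidableEq Y] (F : OrthFlow ι) (κ : ℝ) (ℓ k : ℕ)
    (M : Fin (d + 1) → ℕ) (A₀ : Fin (d + 1) → ℝ) (e : Y → ↥(Box d ℓ k M)) (v : Y × ι → ℝ) (y : Y) :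
    siteNorm (fld (blockDiag (gaugeU d F κ ℓ k M A₀ ∘ e) *ᵥ v) y) = siteNorm (fld v y) := by
  rw [fld_blockDiag_mulVec]
  exact siteNorm_flow F _ _

/-- … nor does its transpose. [cite: Balaban1982Higgs2, p. 573] -/
theorem siteNorm_fld_blockDiag_gaugeU_transpose {Y : Type*} [Fintype Y] [DecidableEq Y] (F : OrthFlow ι) (κ : ℝ)
    (ℓ k : ℕ) (M : Fin (d + 1) → ℕ) (A₀ : Fin (d + 1) → ℝ) (e : Y → ↥(Box d ℓ k M)) (v : Y × ι → ℝ) (y : Y) :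
    siteNorm (fld ((blockDiag (gaugeU d F κ ℓ k M A₀ ∘ e))ᵀ *ᵥ v) y) = siteNorm (fld v y) := by
  rw [B4GaugeCovariance.blockDiag_transpose, fld_blockDiag_mulVec]
  dsimp only [Function.comp, gaugeU]
  rw [F.transpose_eq]
  exact siteNorm_flow F _ _

/-- `‖ℋv‖_∞ = ‖v‖_∞`. [cite: Balaban1982Higgs2, p. 573] -/
theorem supN_blockDiag_gaugeU {Y : Type*} [Fintype Y] [DecidableEq Y] (F : OrthFlow ι) (κ : ℝ) (ℓ k : ℕ)
    (M : Fin (d + 1) → ℕ) (A₀ : Fin (d + 1) → ℝ) (e : Y → ↥(Box d ℓ k M)) (v : Y × ι → ℝ) :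
    supN (blockDiag (gaugeU d F κ ℓ k M A₀ ∘ e) *ᵥ v) = supN v := by
  refine le_antisymm (supN_le (supN_nonneg _) fun y => ?_) (supN_le (supN_nonneg _) fun y => ?_)
  · rw [siteNorm_fld_blockDiag_gaugeU]; exact le_supN v y
  · rw [← siteNorm_fld_blockDiag_gaugeU F κ ℓ k M A₀ e v y]; exact le_supN _ y

/-- `‖ℋᵀv‖_∞ = ‖v‖_∞`. [cite: Balaban1982Higgs2, p. 573] -/
theorem supN_blockDiag_gaugeU_transpose {Y : Type*} [Fintype Y] [DecidableEq Y] (F : OrthFlow ι) (κ : ℝ) (ℓ k : ℕ)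
    (M : Fin (d + 1) → ℕ) (A₀ : Fin (d + 1) → ℝ) (e : Y → ↥(Box d ℓ k M)) (v : Y × ι → ℝ) :
    supN ((blockDiag (gaugeU d F κ ℓ k M A₀ ∘ e))ᵀ *ᵥ v) = supN v := by
  refine le_antisymm (supN_le (supN_nonneg _) fun y => ?_) (supN_le (supN_nonneg _) fun y => ?_)
  · rw [siteNorm_fld_blockDiag_gaugeU_transpose]; exact le_supN v y
  · rw [← siteNorm_fld_blockDiag_gaugeU_transpose F κ ℓ k M A₀ e v y]; exact le_supN _ y

/-- **`‖ℋ(S ⊗ 1)ℋᵀ‖_{∞→∞} ≤ sup_yΣ_x|S(y,x)|`** — the sup-operator bound of a gauge-dressed scalar kernel (used for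
`C^{(k)}(□,A₀)` with `S = C^{(k)}(□)` and the row sums of `c₀e^{−δ₀|y−y′|}`). [cite: Balaban1982Higgs1, Prop. 2.3 (2.36) p. 611] -/
theorem supN_conj_kron_le {Y : Type*} [Fintype Y] [DecidableEq Y] (F : OrthFlow ι) (κ : ℝ) (ℓ k : ℕ)
    (M : Fin (d + 1) → ℕ) (A₀ : Fin (d + 1) → ℝ) (e : Y → ↥(Box d ℓ k M)) (S : Matrix Y Y ℝ) {s : ℝ} (hs : 0 ≤ s)
    (hrow : ∀ y, ∑ y', |S y y'| ≤ s) (v : Y × ι → ℝ) :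
    supN ((blockDiag (gaugeU d F κ ℓ k M A₀ ∘ e) * (S ⊗ₖ (1 : Matrix ι ι ℝ))
      * (blockDiag (gaugeU d F κ ℓ k M A₀ ∘ e))ᵀ) *ᵥ v) ≤ s * supN v := by
  rw [← mulVec_mulVec, ← mulVec_mulVec, supN_blockDiag_gaugeU]
  refine supN_le (mul_nonneg hs (supN_nonneg _)) fun y => (kron_site_le _ _ _).trans ?_
  rw [supN_blockDiag_gaugeU_transpose]
  exact mul_le_mul_of_nonneg_right (hrow y) (supN_nonneg _)

end Norms

/-! ## §4 The expansion of `C^{(k)}(□,Ã)` around `C^{(k)}(□,A₀)` (the «(I.3.44)»-type step of (2.68) for the covariance) -/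

section Expansion

/-- **THE RESOLVENT STEP IN SUP-OPERATOR FORM**: if `C₀M₀ = 1`, `M₁C₁ = 1`, `‖C₀‖ ≤ c₀`, `‖M₁ − M₀‖ ≤ μ` and `2c₀μ ≤ 1`, then
`‖C₁‖ ≤ 2c₀` and `‖C₁ − C₀‖ ≤ 2c₀²μ` (from `C₁ − C₀ = C₀(M₀ − M₁)C₁`; all norms `‖·‖_{∞→∞}` for the sitewise Euclidean
sup norm). [cite: Balaban1982Higgs2, (2.68) p. 572 «Using the expansion formula (I.3.44)»] -/
theorem expansion_bound {m : Type*} [Fintype m] [DecidableEq m] (M₀ M₁ C₀ C₁ : Matrix (m × ι) (m × ι) ℝ)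
    (h0 : C₀ * M₀ = 1) (h1 : M₁ * C₁ = 1) {c₀ μ : ℝ} (hc₀ : 0 ≤ c₀) (hμ : 0 ≤ μ)
    (hC₀ : ∀ v, supN (C₀ *ᵥ v) ≤ c₀ * supN v) (hM : ∀ v, supN ((M₁ - M₀) *ᵥ v) ≤ μ * supN v)
    (hs : 2 * c₀ * μ ≤ 1) :
    (∀ v, supN (C₁ *ᵥ v) ≤ 2 * c₀ * supN v) ∧ ∀ v, supN ((C₁ - C₀) *ᵥ v) ≤ 2 * c₀ ^ 2 * μ * supN v := by
  have hid : C₁ - C₀ = C₀ * (M₀ - M₁) * C₁ := by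
    rw [Matrix.mul_sub, Matrix.sub_mul, h0, Matrix.one_mul, Matrix.mul_assoc, h1, Matrix.mul_one]
  have hM' : ∀ w, supN ((M₀ - M₁) *ᵥ w) ≤ μ * supN w := fun w => by
    rw [show M₀ - M₁ = -(M₁ - M₀) by abel, neg_mulVec, supN_neg]; exact hM w
  have hC₁ : ∀ v, supN (C₁ *ᵥ v) ≤ 2 * c₀ * supN v := by
    intro v
    have h2 : C₁ *ᵥ v = C₀ *ᵥ v + C₀ *ᵥ ((M₀ - M₁) *ᵥ (C₁ *ᵥ v)) := by
      rw [mulVec_mulVec, mulVec_mulVec, ← hid, sub_mulVec, add_sub_cancel]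
    have h3 : supN (C₀ *ᵥ v + C₀ *ᵥ ((M₀ - M₁) *ᵥ (C₁ *ᵥ v))) ≤ c₀ * supN v + c₀ * (μ * supN (C₁ *ᵥ v)) :=
      (supN_add_le _ _).trans (add_le_add (hC₀ v) ((hC₀ _).trans (mul_le_mul_of_nonneg_left (hM' _) hc₀)))
    rw [← h2] at h3
    have h4 : 0 ≤ supN (C₁ *ᵥ v) := supN_nonneg _
    have h5 := supN_nonneg v
    nlinarith
  refine ⟨hC₁, fun v => ?_⟩
  rw [hid, ← mulVec_mulVec, ← mulVec_mulVec]
  calc supN (C₀ *ᵥ ((M₀ - M₁) *ᵥ (C₁ *ᵥ v))) ≤ c₀ * (μ * (2 * c₀ * supN v)) :=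
        (hC₀ _).trans (mul_le_mul_of_nonneg_left ((hM' _).trans (mul_le_mul_of_nonneg_left (hC₁ v) hμ)) hc₀)
    _ = 2 * c₀ ^ 2 * μ * supN v := by ring

variable {d : ℕ}

variable (d) in
/-- **`a_kG_k(□,A)Q_k^*(A)` as an operator** from unit-lattice fields to fine fields (the `g` of (2.67)–(2.68) as a
function of `□₁φ`). [cite: Balaban1982Higgs2, (2.67)–(2.68) p. 572] -/
abbrev gOp (F : OrthFlow ι) (κ : ℝ) (ℓ k : ℕ) (a m2 : ℝ) (M : Fin (d + 1) → ℕ)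
    (emb : ↥(boxDom M) → ↥(Box d ℓ k M)) (Γ : ↥(boxDom M) → ↥(Box d ℓ k M) → List ↥(Box d ℓ k M))
    (A : ↥(Box d ℓ k M) → ↥(Box d ℓ k M) → ℝ) : Matrix (↥(Box d ℓ k M) × ι) (↥(boxDom M) × ι) ℝ :=
  B1.aSeq a ((ℓ : ℝ) + 1) k • (greenA d F κ ℓ k a m2 M emb Γ A * (avgA d F κ ℓ k M emb Γ A)ᵀ)

/-- **THE DIFFERENCE `(Δ^{(k)}(□,Ã) + aL⁻²P(Ã)) − (Δ^{(k)}(□,A₀) + aL⁻²P(A₀))` APPLIED TO A FIELD**: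
`−a_kn^{−(d+1)}[avgÃ(g̃v) − avg₀(g₀v)] + c′[Q̃uᵀ(Q̃uv) − Q₀uᵀ(Q₀uv)]`, `g = a_kG_kQ_k^*` (`gOp`).
[cite: Balaban1983RegularityDecay, (1.13)–(1.14) p. 573; Balaban1982Higgs2, (2.68), (2.73) pp. 572–573] -/
theorem Mop_sub_mulVec (F : OrthFlow ι) (κ : ℝ) (ℓ k : ℕ) (a₂ a m2 : ℝ) (M' : Fin (d + 1) → ℕ)
    (emb : ↥(boxDom (M2 ℓ M')) → ↥(Box d ℓ k (M2 ℓ M')))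
    (Γ : ↥(boxDom (M2 ℓ M')) → ↥(Box d ℓ k (M2 ℓ M')) → List ↥(Box d ℓ k (M2 ℓ M')))
    (emb' : ↥(boxDom M') → ↥(Box d ℓ k (M2 ℓ M')))
    (Γ' : ↥(boxDom M') → ↥(boxDom (M2 ℓ M')) → List ↥(Box d ℓ k (M2 ℓ M')))
    (A A₀b : ↥(Box d ℓ k (M2 ℓ M')) → ↥(Box d ℓ k (M2 ℓ M')) → ℝ) (v : ↥(boxDom (M2 ℓ M')) × ι → ℝ) :
    (Mop d F κ ℓ k a₂ a m2 M' emb Γ emb' Γ' A - Mop d F κ ℓ k a₂ a m2 M' emb Γ emb' Γ' A₀b) *ᵥ v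
      = -(B1.aSeq a ((ℓ : ℝ) + 1) k * ((((ℓ + 1) ^ k : ℕ) : ℝ) ^ (d + 1))⁻¹)
          • (avgA d F κ ℓ k (M2 ℓ M') emb Γ A *ᵥ (gOp d F κ ℓ k a m2 (M2 ℓ M') emb Γ A *ᵥ v)
              - avgA d F κ ℓ k (M2 ℓ M') emb Γ A₀b *ᵥ (gOp d F κ ℓ k a m2 (M2 ℓ M') emb Γ A₀b *ᵥ v))
        + (a₂ / ((ℓ : ℝ) + 1) ^ 2 * ((((ℓ : ℝ) + 1) ^ (d + 1)))⁻¹)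
          • ((avgU d F κ ℓ k M' emb' Γ' A)ᵀ *ᵥ (avgU d F κ ℓ k M' emb' Γ' A *ᵥ v)
              - (avgU d F κ ℓ k M' emb' Γ' A₀b)ᵀ *ᵥ (avgU d F κ ℓ k M' emb' Γ' A₀b *ᵥ v)) := by
  set ak := B1.aSeq a ((ℓ : ℝ) + 1) k with hak
  set ninv := ((((ℓ + 1) ^ k : ℕ) : ℝ) ^ (d + 1))⁻¹ with hninv
  set c' := a₂ / ((ℓ : ℝ) + 1) ^ 2 * ((((ℓ : ℝ) + 1) ^ (d + 1)))⁻¹ with hc'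
  have hS : ∀ B : ↥(Box d ℓ k (M2 ℓ M')) → ↥(Box d ℓ k (M2 ℓ M')) → ℝ,
      (ak ^ 2 * ninv) • (avgA d F κ ℓ k (M2 ℓ M') emb Γ B *ᵥ (greenA d F κ ℓ k a m2 (M2 ℓ M') emb Γ B
          *ᵥ ((avgA d F κ ℓ k (M2 ℓ M') emb Γ B)ᵀ *ᵥ v)))
        = (ak * ninv) • (avgA d F κ ℓ k (M2 ℓ M') emb Γ B *ᵥ (gOp d F κ ℓ k a m2 (M2 ℓ M') emb Γ B *ᵥ v)) := by
    intro B
    dsimp only [gOp]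
    rw [← hak, smul_mulVec, mulVec_smul, smul_smul, ← mulVec_mulVec]
    congr 1
    ring
  unfold Mop
  rw [← hak, ← hninv, ← hc']
  simp only [sub_mulVec, add_mulVec, smul_mulVec (ak ^ 2 * ninv), smul_mulVec c', ← mulVec_mulVec]
  rw [hS A, hS A₀b, smul_sub, smul_sub, neg_smul, neg_smul]
  abel

/-- **THE SIZE OF `(Δ^{(k)}(□,Ã) + aL⁻²P(Ã)) − (Δ^{(k)}(□,A₀) + aL⁻²P(A₀))` IN `‖·‖_{∞→∞}`**, `Ã = A₀ + A′`: at most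
`a_k(ℓ₁τc_I + ρ) + 2aL⁻²ℓ₁τ′`, where `τ, τ′` bound the `A′`-holonomies of the block / unit-level contours ((2.73):
«|Q_k(A₀) − Q_k(A^{(k)})| = O(p r)»), `c_I` bounds `a_kG_k(□,Ã)Q_k^*(Ã)` (Proposition I.2.2) and `ρ` bounds the (2.68)
remainder `a_kG_k(□,Ã)Q_k^*(Ã) − a_kG_k(□,A₀)Q_k^*(A₀)` (`B2Eq268GaugeAway.remainder268_sup`), all in `‖·‖_{∞→∞}`.
[cite: Balaban1982Higgs2, (2.68), (2.73) pp. 572–573, (2.113) p. 581] -/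
theorem Mop_sub_bound (F : OrthFlow ι) {ℓ₁ : ℝ} (hℓ₁ : 0 ≤ ℓ₁)
    (hLip : ∀ t (v : ι → ℝ), ((F.U t - 1) *ᵥ v) ⬝ᵥ ((F.U t - 1) *ᵥ v) ≤ (ℓ₁ * t) ^ 2 * (v ⬝ᵥ v))
    (κ : ℝ) {ℓ k : ℕ} (hℓ : 1 ≤ ℓ) (hk : 1 ≤ k) {a₂ a : ℝ} (ha₂ : 0 ≤ a₂) (ha : 0 < a) (m2 : ℝ)
    (M' : Fin (d + 1) → ℕ)
    (emb : ↥(boxDom (M2 ℓ M')) → ↥(Box d ℓ k (M2 ℓ M')))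
    (Γ : ↥(boxDom (M2 ℓ M')) → ↥(Box d ℓ k (M2 ℓ M')) → List ↥(Box d ℓ k (M2 ℓ M')))
    (emb' : ↥(boxDom M') → ↥(Box d ℓ k (M2 ℓ M')))
    (Γ' : ↥(boxDom M') → ↥(boxDom (M2 ℓ M')) → List ↥(Box d ℓ k (M2 ℓ M')))
    (A₀b A' : ↥(Box d ℓ k (M2 ℓ M')) → ↥(Box d ℓ k (M2 ℓ M')) → ℝ) {τ τ' cI ρ : ℝ} (hτ : 0 ≤ τ) (hτ' : 0 ≤ τ')
    (hcI : 0 ≤ cI) (hρ : 0 ≤ ρ)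
    (hτA : ∀ y x, blkWt ((ℓ + 1) ^ k) (M2 ℓ M') (fun i => (ℓ + 1) ^ k * M2 ℓ M' i) y x ≠ 0 →
      |κ * lsum A' (emb y) (Γ y x)| ≤ τ)
    (hτA' : ∀ z y, blkWt (ℓ + 1) M' (M2 ℓ M') z y ≠ 0 → |κ * lsum A' (emb' z) (Γ' z y)| ≤ τ')
    (hg : ∀ v, supN (gOp d F κ ℓ k a m2 (M2 ℓ M') emb Γ (A₀b + A') *ᵥ v) ≤ cI * supN v)
    (hrem : ∀ v, supN (gOp d F κ ℓ k a m2 (M2 ℓ M') emb Γ (A₀b + A') *ᵥ v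
      - gOp d F κ ℓ k a m2 (M2 ℓ M') emb Γ A₀b *ᵥ v) ≤ ρ * supN v)
    (v : ↥(boxDom (M2 ℓ M')) × ι → ℝ) :
    supN ((Mop d F κ ℓ k a₂ a m2 M' emb Γ emb' Γ' (A₀b + A') - Mop d F κ ℓ k a₂ a m2 M' emb Γ emb' Γ' A₀b) *ᵥ v)
      ≤ (B1.aSeq a ((ℓ : ℝ) + 1) k * (ℓ₁ * τ * cI + ρ) + 2 * (a₂ / ((ℓ : ℝ) + 1) ^ 2) * (ℓ₁ * τ')) * supN v := by
  have hL : (1 : ℝ) < (ℓ : ℝ) + 1 := by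
    have : (1 : ℝ) ≤ (ℓ : ℝ) := by exact_mod_cast hℓ
    linarith
  have hak : 0 < B1.aSeq a ((ℓ : ℝ) + 1) k := B1.aSeq_pos ha hL hk
  set ak := B1.aSeq a ((ℓ : ℝ) + 1) k with hakdef
  set nn : ℝ := ((((ℓ + 1) ^ k : ℕ) : ℝ) ^ (d + 1)) with hnn
  set LL : ℝ := (((ℓ : ℝ) + 1) ^ (d + 1)) with hLL
  have hn1 : 1 ≤ (ℓ + 1) ^ k := Nat.one_le_pow _ _ (Nat.succ_pos ℓ)
  have hnnpos : 0 < nn := by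
    have : (1 : ℝ) ≤ (((ℓ + 1) ^ k : ℕ) : ℝ) := by exact_mod_cast hn1
    positivity
  have hLLpos : 0 < LL := by positivity
  have hv := supN_nonneg v
  set gt := gOp d F κ ℓ k a m2 (M2 ℓ M') emb Γ (A₀b + A') *ᵥ v with hgt
  set g0 := gOp d F κ ℓ k a m2 (M2 ℓ M') emb Γ A₀b *ᵥ v with hg0
  rw [Mop_sub_mulVec]
  -- first bracket
  have h1 : supN (avgA d F κ ℓ k (M2 ℓ M') emb Γ (A₀b + A') *ᵥ gt - avgA d F κ ℓ k (M2 ℓ M') emb Γ A₀b *ᵥ g0)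
      ≤ nn * (ℓ₁ * τ * cI + ρ) * supN v := by
    have hsplit : avgA d F κ ℓ k (M2 ℓ M') emb Γ (A₀b + A') *ᵥ gt - avgA d F κ ℓ k (M2 ℓ M') emb Γ A₀b *ᵥ g0
        = (avgA d F κ ℓ k (M2 ℓ M') emb Γ (A₀b + A') - avgA d F κ ℓ k (M2 ℓ M') emb Γ A₀b) *ᵥ gt
          + avgA d F κ ℓ k (M2 ℓ M') emb Γ A₀b *ᵥ (gt - g0) := by
      rw [sub_mulVec, mulVec_sub]; abel
    rw [hsplit]
    refine (supN_add_le _ _).trans ?_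
    have e1 : supN ((avgA d F κ ℓ k (M2 ℓ M') emb Γ (A₀b + A') - avgA d F κ ℓ k (M2 ℓ M') emb Γ A₀b) *ᵥ gt)
        ≤ nn * (ℓ₁ * τ) * (cI * supN v) :=
      supN_le (by positivity) fun y => (avgA_sub_site_le F hℓ₁ hLip κ k (M2 ℓ M') emb Γ A₀b A' hτ hτA gt y).trans
        (mul_le_mul_of_nonneg_left (hg v) (by positivity))
    have e2 : supN (avgA d F κ ℓ k (M2 ℓ M') emb Γ A₀b *ᵥ (gt - g0)) ≤ nn * (ρ * supN v) :=
      supN_le (by positivity) fun y => (avgA_site_le F κ k (M2 ℓ M') emb Γ A₀b (gt - g0) y).trans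
        (mul_le_mul_of_nonneg_left (hrem v) hnnpos.le)
    nlinarith
  -- second bracket
  have h2 : supN ((avgU d F κ ℓ k M' emb' Γ' (A₀b + A'))ᵀ *ᵥ (avgU d F κ ℓ k M' emb' Γ' (A₀b + A') *ᵥ v)
        - (avgU d F κ ℓ k M' emb' Γ' A₀b)ᵀ *ᵥ (avgU d F κ ℓ k M' emb' Γ' A₀b *ᵥ v))
      ≤ LL * (2 * (ℓ₁ * τ')) * supN v := by
    have hsplit : (avgU d F κ ℓ k M' emb' Γ' (A₀b + A'))ᵀ *ᵥ (avgU d F κ ℓ k M' emb' Γ' (A₀b + A') *ᵥ v)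
          - (avgU d F κ ℓ k M' emb' Γ' A₀b)ᵀ *ᵥ (avgU d F κ ℓ k M' emb' Γ' A₀b *ᵥ v)
        = ((avgU d F κ ℓ k M' emb' Γ' (A₀b + A'))ᵀ - (avgU d F κ ℓ k M' emb' Γ' A₀b)ᵀ)
            *ᵥ (avgU d F κ ℓ k M' emb' Γ' (A₀b + A') *ᵥ v)
          + (avgU d F κ ℓ k M' emb' Γ' A₀b)ᵀ
            *ᵥ ((avgU d F κ ℓ k M' emb' Γ' (A₀b + A') - avgU d F κ ℓ k M' emb' Γ' A₀b) *ᵥ v) := by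
      rw [sub_mulVec, sub_mulVec, mulVec_sub]; abel
    rw [hsplit]
    refine (supN_add_le _ _).trans ?_
    have e1 : supN (((avgU d F κ ℓ k M' emb' Γ' (A₀b + A'))ᵀ - (avgU d F κ ℓ k M' emb' Γ' A₀b)ᵀ)
          *ᵥ (avgU d F κ ℓ k M' emb' Γ' (A₀b + A') *ᵥ v)) ≤ ℓ₁ * τ' * (LL * supN v) :=
      supN_le (by positivity) fun y =>
        (avgUT_sub_site_le F hℓ₁ hLip κ ℓ k M' emb' Γ' A₀b A' hτ' hτA' _ y).trans
          (mul_le_mul_of_nonneg_left (supN_le (by positivity) fun z =>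
            avgU_site_le F κ ℓ k M' emb' Γ' (A₀b + A') v z) (mul_nonneg hℓ₁ hτ'))
    have e2 : supN ((avgU d F κ ℓ k M' emb' Γ' A₀b)ᵀ
          *ᵥ ((avgU d F κ ℓ k M' emb' Γ' (A₀b + A') - avgU d F κ ℓ k M' emb' Γ' A₀b) *ᵥ v))
        ≤ LL * (ℓ₁ * τ') * supN v :=
      supN_le (by positivity) fun y =>
        (avgUT_site_le F κ ℓ k M' emb' Γ' A₀b _ y).trans
          (supN_le (by positivity) fun z => avgU_sub_site_le F hℓ₁ hLip κ ℓ k M' emb' Γ' A₀b A' hτ' hτA' v z)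
    nlinarith
  -- assemble
  refine (supN_add_le _ _).trans ?_
  refine (add_le_add ((supN_smul_le _ _).trans (mul_le_mul_of_nonneg_left h1 (abs_nonneg _)))
    ((supN_smul_le _ _).trans (mul_le_mul_of_nonneg_left h2 (abs_nonneg _)))).trans (le_of_eq ?_)
  rw [abs_neg, abs_of_nonneg (by positivity : 0 ≤ ak * nn⁻¹), abs_of_nonneg (by positivity : 0 ≤ a₂ / ((ℓ : ℝ) + 1) ^ 2 * LL⁻¹)]
  field_simp

end Expansion

end

end Literature.MathematicalPhysics.QuantumFieldTheory.Balaban1983to89.B2Lemma27CovarianceBox
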